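import Literature.MathematicalPhysics.AQFT.StandardSubspaceInclusion
import Literature.MathematicalPhysics.AQFT.StandardSubspaceProofs
import Literature.Analysis.Complex.StripBoundaryValues
import Literature.Analysis.Complex.UpperHalfPlaneSegmentUniqueness
import Literature.Analysis.UnboundedOperators.StrongContRepresentationProofs
import Literature.Analysis.UnboundedOperators.UnitaryGroupGenerator
import Mathlib.Analysis.SpecialFunctions.Complex.LogDeriv
import Mathlib.Analysis.SpecialFunctions.Complex.Arg
import Mathlib.Analysis.InnerProductSpace.Calculus
import Mathlib.Analysis.Calculus.MeanValue
import HarnessLib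

/-!
# The half-sided modular inclusion theorem, one-particle version
# (discharge of `StandardSubspace.Wiesbrock_oneParticle`)

Topic `Literature/MathematicalPhysics/AQFT`, proof companion of `StandardSubspace.lean` and
`StandardSubspaceInclusion.lean`. We prove the named fact `Wiesbrock_oneParticle` (R. Longo,
*Lectures on Conformal Nets I*, Thm. 2.4.1, the standard-subspace version of H.-W. Wiesbrock's
theorem, CMP 157 (1993), whose complete proof is H. Araki, L. Zsidó, RMP 17 (2005), Thm. 2.1):

> Let `K ⊂ H` be a half-sided modular inclusion of standard subspaces, `Δ_H^{-it} K ⊂ K`, `t ≥ 0`.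
> There exists a positive energy unitary representation … the translation unitaries are defined by
> `U(e^{2πt} − 1) = Δ_H^{-it} Δ_K^{it}` and satisfy `U(s)H ⊂ H`, `s ≥ 0`, and `K = U(1)H`;
> moreover `Δ_H^{-it} U(s) Δ_H^{it} = U(e^{2πt} s)` (2.4.6) and `U(s) = e^{isP}`, `P` positive (2.4.5).

We follow Longo's proof (pp. 39–41 of the 2008 draft), itself following Araki–Zsidó, on top of the
analytic family `W(z) = Δ_V^{-iz} Δ_K^{iz}` of `StandardSubspaceInclusion.lean` (Longo Cor. 2.3.2).
Deviations forced by the state of Mathlib (no spectral theorem for unbounded self-adjoint operators,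
no functional calculus for `Δ`) are marked *.

* `stripReparam` — the change of variable `h(z) = (2π)⁻¹ log(1 + e^{2πz})`, a holomorphic self-map of
  the strip `S_{1/2}`, continuous on the closed strip off `i/2`, with its boundary values.
* The reality properties (a1)–(a3) of `W` under the half-sided modular condition
  (`IsHalfSidedModularInclusion.inclusionFamily_ofReal_apply_mem`, `…_symplComp`,
  `inclusionFamily_half_I_add_ofReal_apply_mem_symplComp`).
* `structureFun` and `U_mul_inclusionFamily_stripReparam_mul_U` — Longo's Thm. 2.3.3 in the special
  case needed, i.e. eq. (2.4.4) `Δ_K^{is} W(h(s + t)) Δ_K^{-is} = W(h(t))`: the function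
  `F(z) = ⟪J_K Δ_K^{-iz} y₁, W(h(z + t)) Δ_K^{-iz} y₂⟫` is bounded, holomorphic in the strip, continuous
  on the closed strip off `p = −t + i/2` and real on both boundary lines off `p`, hence constant
  (* by `Literature.Analysis.Complex.eq_const_of_im_eq_zero_on_boundary`, Phragmén–Lindelöf with one
  exceptional boundary point, in place of Schwarz reflection, removable singularities and Liouville);
  totality of `K`, `K'` (`clm_eq_of_forall_inner_eq`).
* `inclusionFamily_ofReal_mul_inclusionFamily_stripReparam` — the composition law
  `W(s) W(h(t)) = W((2π)⁻¹ log(e^{2πs} + e^{2πt}))`; `localGroup` — `U₀(x) = W((2π)⁻¹ log(1 + x))`, the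
  local group law on `x > -1` (`localGroup_add`; * the printed "by analytic continuation, for any real
  arguments" is replaced by the algebraic extension through inverses of unitaries);
  `translationUnitary`, `translationGroup` — the one-parameter unitary group `U(x) = U₀(1)^⌊x⌋ U₀(x − ⌊x⌋)`,
  strongly continuous, with `U = U₀` on `(-1, ∞)` and `U(e^{2πt} − 1) = Δ_V^{-it} Δ_K^{it}`
  (`translationGroup_appReal_exp_sub_one`).
* `U_neg_mul_translation_mul_U` — dilation covariance (2.4.6).
* `translation_apply_mem_V` (`U(x)K ⊆ V`, `x ≥ -1`, (2.4.7)), `U_mul_translation_neg_one`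
  (`Δ_V^{it} U(−1) = U(−1) Δ_K^{it}`), `translation_one_J_translation_neg_one` (`U(1) J_V U(−1) = J_K`, * from
  the uniqueness of the polar continuation `polarExt`, in place of Prop. 2.1.10),
  `mem_iff_exists_translation_one` (`K = U(1)V`, (2.4.8)), `translation_apply_mem_V_of_nonneg`
  (`U(s)V ⊆ V`, `s ≥ 0`).
* `translationExt` — the extension `Ũ(σ) = W((2π)⁻¹ log(1 + σ))` to the closed upper half-plane, bounded
  by `1`, holomorphic inside; `translationExt_add_ofReal_left/right` — `Ũ(σ + s) = U(s)Ũ(σ) = Ũ(σ)U(s)`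
  (analytic continuation from a real segment, `Literature.Analysis.Complex.eq_zero_of_eqOn_real_segment`);
  `hasPositiveEnergy_translationGroup` — * positivity of the generator WITHOUT the spectral theorem: the
  contractions `R(b) = Ũ(ib)` commute with `U`, `b ↦ R(b)x` has derivative `i R(b) A x` for `x ∈ D(A)`
  (Cauchy–Riemann for the holomorphic `σ ↦ Ũ(σ)x`), and `‖R(b)x‖ ≤ ‖x‖` with the mean value theorem gives
  `Re ⟪x, iAx⟫ ≤ 0`, i.e. `⟪x, Px⟫ ≥ 0` for `P = −iA` (`U(t) = e^{itP}`).
* `Wiesbrock_oneParticle_holds`.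

## References

* R. Longo, *Lectures on Conformal Nets. Part I: One Particle Structure* (draft 2008), Thm. 2.4.1 and
  its proof, pp. 38–41 (= §2 of R. Longo, *Real Hilbert subspaces, modular theory, SL(2,ℝ) and CFT*,
  Theta 2008); Thm. 2.3.1, Cor. 2.3.2, Thm. 2.3.3. [Longo2008LecturesConformalNets]
* H.-W. Wiesbrock, *Half-sided modular inclusions of von Neumann algebras*, CMP 157 (1993), Thm. 3,
  Cor. 6–7. [Wiesbrock1993]
* H. Araki, L. Zsidó, *Extension of the structure theorem of Borchers and its application to half-sided
  modular inclusions*, RMP 17 (2005), Thm. 2.1. [ArakiZsido2005]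

No named facts are introduced; all definitions have bodies.
-/

noncomputable section

open Complex ComplexConjugate ClosedSubmodule Set Filter
open scoped InnerProductSpace Topology Real

namespace Literature.MathematicalPhysics.AQFT

namespace StandardSubspace

open Literature.Analysis.UnboundedOperators


/-! ### The map `h(z) = (2π)⁻¹ log(1 + e^{2πz})` (Longo, proof of Thm. 2.4.1) -/

/-- Longo's change of variable `h(z) = (2π)⁻¹ log(1 + e^{2πz})` (principal logarithm), a conformal
map of the strip `S_{1/2}` onto itself which opens up the boundary point `i/2`
(Longo, proof of Thm. 2.4.1, p. 39: "`h(z) ≡ (1/2π) log(1 + e^{2πz})`, `z ∈ S_{1/2}` … maps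
conformally `S_{1/2}` onto `S_{1/2}`"). [cite: Longo2008LecturesConformalNets, Thm. 2.4.1 (proof)] -/
def stripReparam (z : ℂ) : ℂ := (2 * π : ℂ)⁻¹ * log (1 + exp (2 * π * z))

/-- Imaginary part of `1 + e^{2πz}`. [folklore] -/
theorem one_add_exp_im (z : ℂ) : (1 + exp (2 * π * z)).im = Real.exp (2 * π * z.re) * Real.sin (2 * π * z.im) := by
  simp [exp_im, mul_re, mul_im]

/-- Real part of `1 + e^{2πz}`. [folklore] -/
theorem one_add_exp_re (z : ℂ) : (1 + exp (2 * π * z)).re = 1 + Real.exp (2 * π * z.re) * Real.cos (2 * π * z.im) := by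
  simp [exp_re, mul_re, mul_im]

/-- On the closed strip `0 ≤ Im z ≤ 1/2`, `1 + e^{2πz}` lies in the closed upper half-plane. [folklore] -/
theorem one_add_exp_im_nonneg {z : ℂ} (hz : z ∈ closedStrip 2⁻¹) : 0 ≤ (1 + exp (2 * π * z)).im := by
  rw [one_add_exp_im]
  refine mul_nonneg (Real.exp_pos _).le (Real.sin_nonneg_of_nonneg_of_le_pi ?_ ?_)
  · exact mul_nonneg (by positivity) hz.1
  · calc 2 * π * z.im ≤ 2 * π * 2⁻¹ := by gcongr; exact hz.2
      _ = π := by ring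

/-- On the open strip, `1 + e^{2πz}` lies in the open upper half-plane. [folklore] -/
theorem one_add_exp_im_pos {z : ℂ} (hz : z ∈ openStrip 2⁻¹) : 0 < (1 + exp (2 * π * z)).im := by
  rw [one_add_exp_im]
  refine mul_pos (Real.exp_pos _) (Real.sin_pos_of_pos_of_lt_pi ?_ ?_)
  · exact mul_pos (by positivity) hz.1
  · calc 2 * π * z.im < 2 * π * 2⁻¹ := by gcongr; exact hz.2
      _ = π := by ring

/-- `1 + e^{2πz} ≠ 0` on the closed strip off `i/2`. [folklore] -/
theorem one_add_exp_ne_zero {z : ℂ} (hz : z ∈ closedStrip 2⁻¹) (hzp : z ≠ (2⁻¹ : ℂ) * I) :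
    1 + exp (2 * π * z) ≠ 0 := by
  intro h0
  have him : Real.exp (2 * π * z.re) * Real.sin (2 * π * z.im) = 0 := by
    rw [← one_add_exp_im, h0, zero_im]
  have hre : 1 + Real.exp (2 * π * z.re) * Real.cos (2 * π * z.im) = 0 := by
    rw [← one_add_exp_re, h0, zero_re]
  have hsin : Real.sin (2 * π * z.im) = 0 := by
    rcases mul_eq_zero.1 him with h | h
    · exact absurd h (Real.exp_pos _).ne'
    · exact h
  -- `sin (2π y) = 0` with `2π y ∈ [0, π]` forces `y = 0` or `y = 1/2`
  have hy0 : 0 ≤ 2 * π * z.im := mul_nonneg (by positivity) hz.1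
  have hyπ : 2 * π * z.im ≤ π := by
    calc 2 * π * z.im ≤ 2 * π * 2⁻¹ := by gcongr; exact hz.2
      _ = π := by ring
  rcases hyπ.eq_or_lt with heq | hlt
  · -- `y = 1/2`: then `1 - e^{2πx} = 0`, so `x = 0` and `z = i/2`
    rw [heq, Real.cos_pi, mul_neg_one] at hre
    have hx : z.re = 0 := by
      have h1 : Real.exp (2 * π * z.re) = 1 := by linarith
      rw [Real.exp_eq_one_iff] at h1
      have h2 : (2 * π) ≠ 0 := by positivity
      exact (mul_eq_zero.1 h1).resolve_left h2
    have hy : z.im = 2⁻¹ := by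
      have h2 : (2 * π) ≠ 0 := by positivity
      field_simp at heq
      linarith
    exact hzp (Complex.ext (by simp [hx]) (by simp [hy]))
  · -- `0 ≤ 2πy < π` and `sin = 0` force `y = 0`, and then the real part is `> 0`
    have hyz : 2 * π * z.im = 0 := by
      by_contra hne
      have hpos : 0 < 2 * π * z.im := lt_of_le_of_ne hy0 (Ne.symm hne)
      exact (Real.sin_pos_of_pos_of_lt_pi hpos hlt).ne' hsin
    rw [hyz, Real.cos_zero, mul_one] at hre
    linarith [Real.exp_pos (2 * π * z.re)]

/-- On the open strip, `1 + e^{2πz}` is in the slit plane. [folklore] -/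
theorem one_add_exp_mem_slitPlane {z : ℂ} (hz : z ∈ openStrip 2⁻¹) : 1 + exp (2 * π * z) ∈ slitPlane :=
  mem_slitPlane_iff.2 (Or.inr (one_add_exp_im_pos hz).ne')

/-- The imaginary part of `h(z)` is `arg(1 + e^{2πz}) / 2π`. [folklore] -/
theorem stripReparam_im (z : ℂ) : (stripReparam z).im = (2 * π)⁻¹ * arg (1 + exp (2 * π * z)) := by
  rw [stripReparam, show (2 * π : ℂ)⁻¹ = (((2 * π)⁻¹ : ℝ) : ℂ) by push_cast; ring, im_ofReal_mul, log_im]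

/-- **`h` maps the closed strip off `i/2` into the closed strip.** [cite: Longo2008LecturesConformalNets, Thm. 2.4.1 (proof)] -/
theorem stripReparam_mem_closedStrip {z : ℂ} (hz : z ∈ closedStrip 2⁻¹) :
    stripReparam z ∈ closedStrip 2⁻¹ := by
  rw [mem_closedStrip_iff, stripReparam_im]
  have h2π : 0 < (2 * π)⁻¹ := by positivity
  constructor
  · exact mul_nonneg h2π.le (arg_nonneg_iff.2 (one_add_exp_im_nonneg hz))
  · calc (2 * π)⁻¹ * arg (1 + exp (2 * π * z)) ≤ (2 * π)⁻¹ * π := by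
          gcongr; exact arg_le_pi _
      _ = 2⁻¹ := by field_simp

/-- **`h` maps the open strip into the open strip.** [cite: Longo2008LecturesConformalNets, Thm. 2.4.1 (proof)] -/
theorem stripReparam_mem_openStrip {z : ℂ} (hz : z ∈ openStrip 2⁻¹) :
    stripReparam z ∈ openStrip 2⁻¹ := by
  rw [mem_openStrip_iff, stripReparam_im]
  have h2π : 0 < (2 * π)⁻¹ := by positivity
  have him := one_add_exp_im_pos hz
  constructor
  · refine mul_pos h2π (lt_of_le_of_ne (arg_nonneg_iff.2 him.le) fun h => ?_)
    exact him.ne' (arg_eq_zero_iff.1 h.symm).2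
  · have hlt : arg (1 + exp (2 * π * z)) < π := arg_lt_pi_iff.2 (Or.inr him.ne')
    calc (2 * π)⁻¹ * arg (1 + exp (2 * π * z)) < (2 * π)⁻¹ * π := by gcongr
      _ = 2⁻¹ := by field_simp

/-- **`h` is holomorphic on the open strip.** [cite: Longo2008LecturesConformalNets, Thm. 2.4.1 (proof)] -/
theorem differentiableOn_stripReparam : DifferentiableOn ℂ stripReparam (openStrip 2⁻¹) := by
  intro z hz
  have hE : DifferentiableAt ℂ (fun w : ℂ => 1 + exp (2 * π * w)) z :=
    (differentiableAt_const _).add ((differentiableAt_id.const_mul _).cexp)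
  exact ((hE.clog (one_add_exp_mem_slitPlane hz)).const_mul ((2 * π : ℂ)⁻¹)).differentiableWithinAt

/-- **`h` is continuous on the closed strip off `i/2`** (within the closed strip the principal
logarithm is continuous up to the negative real axis from above). [cite: Longo2008LecturesConformalNets, Thm. 2.4.1 (proof)] -/
theorem continuousOn_stripReparam : ContinuousOn stripReparam (closedStrip 2⁻¹ \ {(2⁻¹ : ℂ) * I}) := by
  intro z hz
  have hE : ContinuousWithinAt (fun w : ℂ => 1 + exp (2 * π * w)) (closedStrip 2⁻¹ \ {(2⁻¹ : ℂ) * I}) z :=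
    (continuous_const.add ((continuous_const.mul continuous_id).cexp)).continuousWithinAt
  have hmaps : MapsTo (fun w : ℂ => 1 + exp (2 * π * w)) (closedStrip 2⁻¹ \ {(2⁻¹ : ℂ) * I})
      {w : ℂ | 0 ≤ w.im} := fun w hw => one_add_exp_im_nonneg hw.1
  have hlog : ContinuousWithinAt log {w : ℂ | 0 ≤ w.im} (1 + exp (2 * π * z)) := by
    by_cases hs : 1 + exp (2 * π * z) ∈ slitPlane
    · exact (continuousAt_clog hs).continuousWithinAt
    · -- not in the slit plane and non-zero: a negative real, approached from above
      have hne := one_add_exp_ne_zero hz.1 hz.2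
      rw [mem_slitPlane_iff, not_or, not_lt, not_ne_iff] at hs
      refine continuousWithinAt_log_of_re_neg_of_im_zero (lt_of_le_of_ne hs.1 fun h => hne ?_) hs.2
      exact Complex.ext h hs.2
  have hcomp : ContinuousWithinAt (fun w : ℂ => log (1 + exp (2 * π * w)))
      (closedStrip 2⁻¹ \ {(2⁻¹ : ℂ) * I}) z := hlog.comp (f := fun w : ℂ => 1 + exp (2 * π * w)) hE hmaps
  exact hcomp.const_mul ((2 * π : ℂ)⁻¹)

/-- `e^{2π s}` for real `s`, as a real exponential. [folklore] -/
theorem exp_two_pi_mul_ofReal (s : ℝ) : exp (2 * π * (s : ℂ)) = (Real.exp (2 * π * s) : ℝ) := by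
  rw [Complex.ofReal_exp]; push_cast; ring_nf

/-- `e^{2π(i/2 + s)} = -e^{2πs}`. [folklore] -/
theorem exp_two_pi_mul_half_I_add_ofReal (s : ℝ) :
    exp (2 * π * ((2⁻¹ : ℂ) * I + s)) = -(Real.exp (2 * π * s) : ℝ) := by
  rw [mul_add, Complex.exp_add, show 2 * (π : ℂ) * (2⁻¹ * I) = π * I by ring, exp_pi_mul_I,
    exp_two_pi_mul_ofReal]
  ring

/-- **Real boundary values**: `h(s) = (2π)⁻¹ log(1 + e^{2πs})` is real (and positive) for real `s`.
[cite: Longo2008LecturesConformalNets, Thm. 2.4.1 (proof)] -/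
theorem stripReparam_ofReal (s : ℝ) :
    stripReparam s = (((2 * π)⁻¹ * Real.log (1 + Real.exp (2 * π * s)) : ℝ) : ℂ) := by
  rw [stripReparam, exp_two_pi_mul_ofReal, show (1 : ℂ) + (Real.exp (2 * π * s) : ℝ) =
    ((1 + Real.exp (2 * π * s) : ℝ) : ℂ) by push_cast; ring, ← ofReal_log (by positivity)]
  push_cast; ring

/-- **Upper boundary values, left half**: for `s < 0`, `h(i/2 + s) = (2π)⁻¹ log(1 − e^{2πs})` is real
(and negative). [cite: Longo2008LecturesConformalNets, Thm. 2.4.1 (proof)] -/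
theorem stripReparam_half_I_add_ofReal_of_neg {s : ℝ} (hs : s < 0) :
    stripReparam ((2⁻¹ : ℂ) * I + s) = (((2 * π)⁻¹ * Real.log (1 - Real.exp (2 * π * s)) : ℝ) : ℂ) := by
  have hlt : Real.exp (2 * π * s) < 1 :=
    Real.exp_lt_one_iff.2 (mul_neg_of_pos_of_neg (by positivity) hs)
  rw [stripReparam, exp_two_pi_mul_half_I_add_ofReal, show (1 : ℂ) + -((Real.exp (2 * π * s) : ℝ) : ℂ) =
    ((1 - Real.exp (2 * π * s) : ℝ) : ℂ) by push_cast; ring, ← ofReal_log (by linarith)]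
  push_cast; ring

/-- **Upper boundary values, right half**: for `0 < s`, `h(i/2 + s) = i/2 + (2π)⁻¹ log(e^{2πs} − 1)`
(the principal logarithm of the negative real `1 − e^{2πs}`).
[cite: Longo2008LecturesConformalNets, Thm. 2.4.1 (proof)] -/
theorem stripReparam_half_I_add_ofReal_of_pos {s : ℝ} (hs : 0 < s) :
    stripReparam ((2⁻¹ : ℂ) * I + s) =
      (2⁻¹ : ℂ) * I + (((2 * π)⁻¹ * Real.log (Real.exp (2 * π * s) - 1) : ℝ) : ℂ) := by
  have hgt : 1 < Real.exp (2 * π * s) := by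
    exact Real.one_lt_exp_iff.2 (by positivity)
  have hneg : (1 - Real.exp (2 * π * s)) < 0 := by linarith
  have hE : (1 : ℂ) + -((Real.exp (2 * π * s) : ℝ) : ℂ) = ((1 - Real.exp (2 * π * s) : ℝ) : ℂ) := by
    push_cast; ring
  have hlog : log (((1 - Real.exp (2 * π * s) : ℝ) : ℂ)) = (Real.log (Real.exp (2 * π * s) - 1) : ℝ) + π * I := by
    apply Complex.ext
    · simp only [log_re, Complex.norm_real, Real.norm_eq_abs, abs_of_neg hneg, neg_sub, add_re, ofReal_re,
        mul_re, ofReal_im, I_re, I_im, mul_zero, mul_one, sub_self, add_zero]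
    · simp only [log_im, arg_ofReal_of_neg hneg, add_im, ofReal_im, mul_im, ofReal_re, I_re, I_im,
        mul_zero, mul_one, zero_add, add_zero]
  rw [stripReparam, exp_two_pi_mul_half_I_add_ofReal, hE, hlog]
  push_cast
  field_simp
  ring


/-! ### Consequences of the half-sided modular condition -/

section HSM

variable {H : Type*} [NormedAddCommGroup H] [InnerProductSpace ℂ H] [CompleteSpace H]
variable {K V : StandardSubspace H} {DK : ModularData K} {DV : ModularData V}

namespace IsHalfSidedModularInclusion

/-- The inclusion `K ⊆ V` of a half-sided modular inclusion. [cite: Longo2008LecturesConformalNets, §2.4 p. 38 (definition)] -/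
theorem le (h : IsHalfSidedModularInclusion K V DV) : K.toClosedSubmodule ≤ V.toClosedSubmodule := h.1

/-- `Δ_V^{-it} K ⊆ K` for `t ≥ 0`. [cite: Longo2008LecturesConformalNets, §2.4 p. 38 (definition)] -/
theorem U_neg_apply_mem (h : IsHalfSidedModularInclusion K V DV) {t : ℝ} (ht : 0 ≤ t) {x : H}
    (hx : x ∈ K.toClosedSubmodule) : DV.U.appReal (-t) x ∈ K.toClosedSubmodule := h.2 t ht x hx

/-- `Δ_V^{it} K ⊆ K` for `t ≤ 0`. [cite: Longo2008LecturesConformalNets, §2.4 p. 38 (definition)] -/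
theorem U_apply_mem_of_nonpos (h : IsHalfSidedModularInclusion K V DV) {t : ℝ} (ht : t ≤ 0) {x : H}
    (hx : x ∈ K.toClosedSubmodule) : DV.U.appReal t x ∈ K.toClosedSubmodule := by
  have := h.U_neg_apply_mem (neg_nonneg.2 ht) hx
  rwa [neg_neg] at this

/-- **`Δ_V^{it} K' ⊆ K'` for `t ≥ 0`** (Longo, proof of Thm. 2.4.1: "`Δ_H^{is} K' ⊂ K' ⇔ Δ_H^{-is} K ⊂ K`",
by unitarity and the definition of the symplectic complement). [cite: Longo2008LecturesConformalNets, Thm. 2.4.1 (proof, (a2))] -/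
theorem U_apply_mem_symplComp (h : IsHalfSidedModularInclusion K V DV) {t : ℝ} (ht : 0 ≤ t) {x : H}
    (hx : x ∈ K.symplComp.toClosedSubmodule) : DV.U.appReal t x ∈ K.symplComp.toClosedSubmodule := by
  rw [mem_symplComp_iff'] at hx ⊢
  intro y hy
  rw [ModularData.inner_appReal_right_eq]
  exact hx _ (h.U_neg_apply_mem ht hy)

/-- **`W(r) K ⊆ K` for `r ≥ 0`** (`W(r) = Δ_V^{-ir} Δ_K^{ir}`; Longo, proof of Thm. 2.4.1, (a1):
"`W(s)K = Δ_H^{-is} Δ_K^{is} K ⊂ Δ_H^{-is} K = K`"). [cite: Longo2008LecturesConformalNets, Thm. 2.4.1 (proof, (a1))] -/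
theorem inclusionFamily_ofReal_apply_mem (h : IsHalfSidedModularInclusion K V DV) {r : ℝ} (hr : 0 ≤ r)
    {x : H} (hx : x ∈ K.toClosedSubmodule) :
    inclusionFamily DK DV h.le r x ∈ K.toClosedSubmodule := by
  rw [inclusionFamily_ofReal, mul_apply_eq_comp]
  exact h.U_neg_apply_mem hr (DK.U_mem r x hx)

/-- `W(r) K ⊆ V` for every real `r`. [cite: Longo2008LecturesConformalNets, Thm. 2.4.1 (proof, (2.4.7))] -/
theorem inclusionFamily_ofReal_apply_mem_V (h : IsHalfSidedModularInclusion K V DV) (r : ℝ)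
    {x : H} (hx : x ∈ K.toClosedSubmodule) :
    inclusionFamily DK DV h.le r x ∈ V.toClosedSubmodule := by
  rw [inclusionFamily_ofReal, mul_apply_eq_comp]
  exact DV.U_mem (-r) _ (h.le (DK.U_mem r x hx))

/-- **`W(r) K' ⊆ K'` for `r ≤ 0`** (Longo, proof of Thm. 2.4.1, (a2)). [cite: Longo2008LecturesConformalNets, Thm. 2.4.1 (proof, (a2))] -/
theorem inclusionFamily_ofReal_apply_mem_symplComp (h : IsHalfSidedModularInclusion K V DV) {r : ℝ}
    (hr : r ≤ 0) {x : H} (hx : x ∈ K.symplComp.toClosedSubmodule) :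
    inclusionFamily DK DV h.le r x ∈ K.symplComp.toClosedSubmodule := by
  rw [inclusionFamily_ofReal, mul_apply_eq_comp]
  exact h.U_apply_mem_symplComp (neg_nonneg.2 hr) (DK.U_mem_symplComp r hx)

/-- **`W(r + i/2) K' ⊆ K'`** for every real `r` (`W(r + i/2) = J_V W(r) J_K` maps `K'` into
`J_V V = V' ⊆ K'`; Longo, proof of Thm. 2.4.1, (a3)). [cite: Longo2008LecturesConformalNets, Thm. 2.4.1 (proof, (a3))] -/
theorem inclusionFamily_half_I_add_ofReal_apply_mem_symplComp (h : IsHalfSidedModularInclusion K V DV)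
    (r : ℝ) {x : H} (hx : x ∈ K.symplComp.toClosedSubmodule) :
    inclusionFamily DK DV h.le ((2⁻¹ : ℂ) * I + r) x ∈ K.symplComp.toClosedSubmodule := by
  rw [inclusionFamily_half_I_add_ofReal_apply]
  exact symplComp_le_symplComp_of_le h.le
    (DV.J_mem _ (DV.U_mem (-r) _ (h.le (DK.U_mem r _ (DK.J_mem_of_mem_symplComp x hx)))))

end IsHalfSidedModularInclusion

/-! ### The structure argument (Longo Thm. 2.3.3, specialised): `Δ_K^{is} T(s + t) Δ_K^{-is} = T(t)` -/

/-- Longo's function `F` in the proof of Thm. 2.3.3 (with `H = K`, `T(z) = W(h(z))`,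
`ξ' = J_K y₁ ∈ K'`, `η = y₂ ∈ K`): `F(z) = ⟪J_K Δ_K^{-iz} y₁, W(h(z + t)) Δ_K^{-iz} y₂⟫`, i.e.
"`F(s) = (ξ', Δ_K^{is} T(s + t) Δ_K^{-is} η)`" continued analytically in `s`.
[cite: Longo2008LecturesConformalNets, Thm. 2.3.3 (proof)] -/
def structureFun (DK : ModularData K) (DV : ModularData V) (hKV : K.toClosedSubmodule ≤ V.toClosedSubmodule)
    (t : ℝ) (y₁ y₂ : tomitaDomain K) (z : ℂ) : ℂ :=
  ⟪DK.J (DK.polarExt y₁ z), inclusionFamily DK DV hKV (stripReparam (z + t)) (DK.polarExt y₂ z)⟫_ℂ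

variable (hKV : K.toClosedSubmodule ≤ V.toClosedSubmodule)

/-- Shifting by a real number preserves the open strip. [folklore] -/
theorem add_ofReal_mem_openStrip {a : ℝ} {z : ℂ} (hz : z ∈ openStrip a) (t : ℝ) : z + t ∈ openStrip a := by
  simpa [mem_openStrip_iff] using hz

/-- Shifting by a real number preserves the closed strip. [folklore] -/
theorem add_ofReal_mem_closedStrip {a : ℝ} {z : ℂ} (hz : z ∈ closedStrip a) (t : ℝ) : z + t ∈ closedStrip a := by
  simpa [mem_closedStrip_iff] using hz

/-- `F` is holomorphic on the open strip. [cite: Longo2008LecturesConformalNets, Thm. 2.3.3 (proof)] -/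
theorem differentiableOn_structureFun (t : ℝ) (y₁ y₂ : tomitaDomain K) :
    DifferentiableOn ℂ (structureFun DK DV hKV t y₁ y₂) (openStrip 2⁻¹) := by
  have heq : structureFun DK DV hKV t y₁ y₂ = fun z =>
      ((innerSL ℂ (E := H)).comp DK.J.toLinearIsometry.toContinuousLinearMap) (DK.polarExt y₁ z)
        (inclusionFamily DK DV hKV (stripReparam (z + t)) (DK.polarExt y₂ z)) := rfl
  rw [heq]
  refine ((ContinuousLinearMap.differentiable _).comp_differentiableOn (DK.differentiableOn_polarExt y₁)).clm_apply ?_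
  have hW : DifferentiableOn ℂ (fun z => inclusionFamily DK DV hKV (stripReparam (z + t))) (openStrip 2⁻¹) := by
    refine (differentiableOn_inclusionFamily DK DV hKV).comp
      (differentiableOn_stripReparam.comp (differentiableOn_id.add_const _) fun z hz => add_ofReal_mem_openStrip hz t)
      fun z hz => stripReparam_mem_openStrip (add_ofReal_mem_openStrip hz t)
  exact hW.clm_apply (DK.differentiableOn_polarExt y₂)

/-- `F` is continuous on the closed strip off `p = -t + i/2`. [cite: Longo2008LecturesConformalNets, Thm. 2.3.3 (proof)] -/
theorem continuousOn_structureFun (t : ℝ) (y₁ y₂ : tomitaDomain K) :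
    ContinuousOn (structureFun DK DV hKV t y₁ y₂) (closedStrip 2⁻¹ \ {(2⁻¹ : ℂ) * I + ((-t : ℝ) : ℂ)}) := by
  refine continuousOn_inner_inclusionFamily_comp DK DV hKV
    (DK.J.continuous.comp_continuousOn ((DK.continuousOn_polarExt y₁).mono fun _ hz => hz.1))
    ((DK.continuousOn_polarExt y₂).mono fun _ hz => hz.1) ?_ ?_
  · refine continuousOn_stripReparam.comp (continuousOn_id.add continuousOn_const) ?_
    rintro z ⟨hz, hzp⟩
    refine ⟨add_ofReal_mem_closedStrip hz t, fun h => hzp ?_⟩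
    have h' : z + t = (2⁻¹ : ℂ) * I := h
    show z = (2⁻¹ : ℂ) * I + ((-t : ℝ) : ℂ)
    rw [← h']; push_cast; ring
  · exact fun z hz => stripReparam_mem_closedStrip (add_ofReal_mem_closedStrip hz.1 t)

/-- `F` is bounded on the closed strip (indeed everywhere). [cite: Longo2008LecturesConformalNets, Thm. 2.3.3 (proof)] -/
theorem norm_structureFun_le (t : ℝ) (y₁ y₂ : tomitaDomain K) (z : ℂ) :
    ‖structureFun DK DV hKV t y₁ y₂ z‖ ≤
      (‖(y₁ : H)‖ + ‖tomitaOperator K y₁‖) * (‖(y₂ : H)‖ + ‖tomitaOperator K y₂‖) := by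
  refine (norm_inner_le_norm _ _).trans (mul_le_mul ?_ ?_ (norm_nonneg _) (by positivity))
  · rw [LinearIsometryEquiv.norm_map]; exact DK.norm_polarExt_le y₁ z
  · exact (norm_inclusionFamily_apply_le DK DV hKV _ _).trans (DK.norm_polarExt_le y₂ z)

/-- **`F` is real on the lower boundary line** (`W(h(s + t)) Δ_K^{-is} η ∈ K`, `Δ_K^{-is} ξ' ∈ K'`;
Longo, proof of Thm. 2.3.3: "by the assumed reality properties, `F(s)` is real").
[cite: Longo2008LecturesConformalNets, Thm. 2.3.3 (proof)] -/
theorem structureFun_ofReal_im (h : IsHalfSidedModularInclusion K V DV) (t : ℝ) {y₁ y₂ : tomitaDomain K}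
    (hy₁ : (y₁ : H) ∈ K.toClosedSubmodule) (hy₂ : (y₂ : H) ∈ K.toClosedSubmodule) (r : ℝ) :
    (structureFun DK DV h.le t y₁ y₂ r).im = 0 := by
  rw [structureFun, DK.polarExt_ofReal, DK.polarExt_ofReal, DK.J_U,
    show (r : ℂ) + t = ((r + t : ℝ) : ℂ) by push_cast; ring, stripReparam_ofReal]
  refine im_inner_eq_zero_of_mem_symplComp_of_mem K (DK.U_mem_symplComp (-r) (DK.J_mem _ hy₁))
    (h.inclusionFamily_ofReal_apply_mem ?_ (DK.U_mem (-r) _ hy₂))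
  exact mul_nonneg (by positivity) (Real.log_nonneg (by linarith [Real.exp_pos (2 * π * (r + t))]))

/-- **`F` is real on the upper boundary line off `p`** (Longo, proof of Thm. 2.3.3: "`F(s + i/2)` is
real for all `s ∈ ℝ`, `s + t ≠ 0`", through the reality properties (a2), (a3) of Thm. 2.4.1).
[cite: Longo2008LecturesConformalNets, Thm. 2.3.3 (proof)] -/
theorem structureFun_half_I_add_ofReal_im (h : IsHalfSidedModularInclusion K V DV) (t : ℝ)
    {y₁ y₂ : tomitaDomain K} (hy₁ : (y₁ : H) ∈ K.toClosedSubmodule) (hy₂ : (y₂ : H) ∈ K.toClosedSubmodule)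
    {r : ℝ} (hr : r + t ≠ 0) :
    (structureFun DK DV h.le t y₁ y₂ ((2⁻¹ : ℂ) * I + r)).im = 0 := by
  rw [structureFun, DK.polarExt_ofReal_add_half_I, DK.polarExt_ofReal_add_half_I,
    (tomitaOperator_eq_self_iff y₁).2 hy₁, (tomitaOperator_eq_self_iff y₂).2 hy₂, DK.J_U, DK.J_J,
    show (2⁻¹ : ℂ) * I + r + t = (2⁻¹ : ℂ) * I + ((r + t : ℝ) : ℂ) by push_cast; ring]
  have hK : DK.U.appReal (-r) (y₁ : H) ∈ K.toClosedSubmodule := DK.U_mem (-r) _ hy₁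
  have hK' : DK.U.appReal (-r) (DK.J y₂) ∈ K.symplComp.toClosedSubmodule :=
    DK.U_mem_symplComp (-r) (DK.J_mem _ hy₂)
  rcases lt_or_gt_of_ne hr with hlt | hgt
  · rw [stripReparam_half_I_add_ofReal_of_neg hlt]
    refine im_inner_eq_zero_of_mem_of_mem_symplComp K hK (h.inclusionFamily_ofReal_apply_mem_symplComp ?_ hK')
    have hexp : Real.exp (2 * π * (r + t)) < 1 :=
      Real.exp_lt_one_iff.2 (mul_neg_of_pos_of_neg (by positivity) hlt)
    refine mul_nonpos_of_nonneg_of_nonpos (by positivity) (Real.log_nonpos (by linarith) ?_)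
    linarith [Real.exp_pos (2 * π * (r + t))]
  · rw [stripReparam_half_I_add_ofReal_of_pos hgt]
    exact im_inner_eq_zero_of_mem_of_mem_symplComp K hK
      (h.inclusionFamily_half_I_add_ofReal_apply_mem_symplComp _ hK')

/-- **`F` is constant on the closed strip off `p`** (Longo, proof of Thm. 2.3.3: "by the Schwarz
reflection principle … Liouville theorem"; here `Literature.Analysis.Complex.eq_const_of_im_eq_zero_on_boundary`,
Phragmén–Lindelöf with the exceptional boundary point `p`). [cite: Longo2008LecturesConformalNets, Thm. 2.3.3 (proof)] -/
theorem structureFun_eq (h : IsHalfSidedModularInclusion K V DV) (t : ℝ) {y₁ y₂ : tomitaDomain K}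
    (hy₁ : (y₁ : H) ∈ K.toClosedSubmodule) (hy₂ : (y₂ : H) ∈ K.toClosedSubmodule) (s : ℝ) :
    structureFun DK DV h.le t y₁ y₂ s = structureFun DK DV h.le t y₁ y₂ 0 := by
  have hp : ((2⁻¹ : ℂ) * I + ((-t : ℝ) : ℂ)).im = 2⁻¹ := by
    rw [add_im, half_I_im, ofReal_im, add_zero]
  refine Literature.Analysis.Complex.eq_const_of_im_eq_zero_on_boundary (by norm_num : (0 : ℝ) < 2⁻¹) hp
    (differentiableOn_structureFun h.le t y₁ y₂) (continuousOn_structureFun h.le t y₁ y₂)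
    (K := (‖(y₁ : H)‖ + ‖tomitaOperator K y₁‖) * (‖(y₂ : H)‖ + ‖tomitaOperator K y₂‖))
    (fun z _ => norm_structureFun_le h.le t y₁ y₂ z) (fun z hz => ?_) (fun z hz hzp => ?_)
    ⟨⟨by simp, by simp⟩, fun heq => ?_⟩
  · obtain ⟨r, rfl⟩ : ∃ r : ℝ, (r : ℂ) = z := ⟨z.re, Complex.ext (by simp) (by simp [hz])⟩
    exact structureFun_ofReal_im h t hy₁ hy₂ r
  · obtain ⟨r, rfl⟩ : ∃ r : ℝ, (2⁻¹ : ℂ) * I + r = z :=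
      ⟨z.re, Complex.ext (by simp) (by rw [add_im, half_I_im, ofReal_im, add_zero, hz])⟩
    refine structureFun_half_I_add_ofReal_im h t hy₁ hy₂ fun hr => hzp ?_
    rw [show r = -t by linarith]
  · have := congrArg im heq
    rw [ofReal_im, hp] at this
    norm_num at this

/-- **The covariance identity (2.4.4)**: `Δ_K^{is} W(h(s + t)) Δ_K^{-is} = W(h(t))` for all real
`s, t` (Longo Thm. 2.3.3 applied to `T = W ∘ h`, eq. (2.4.4): "`Δ_K^{is} W((1/2π) log(1 + e^{2πt})) Δ_K^{-is}
= W((1/2π) log(1 + e^{2π(t-s)}))`", here with `t` replaced by `s + t`).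
[cite: Longo2008LecturesConformalNets, Thm. 2.4.1 (proof, (2.4.4))] -/
theorem U_mul_inclusionFamily_stripReparam_mul_U (h : IsHalfSidedModularInclusion K V DV) (s t : ℝ) :
    DK.U.appReal s * inclusionFamily DK DV h.le (stripReparam ((s + t : ℝ) : ℂ)) * DK.U.appReal (-s) =
      inclusionFamily DK DV h.le (stripReparam (t : ℂ)) := by
  refine clm_eq_of_forall_inner_eq K fun η hη ξ' hξ' => ?_
  set y₁ : tomitaDomain K := ⟨DK.J ξ', mem_tomitaDomain_of_mem K (DK.J_mem_of_mem_symplComp ξ' hξ')⟩ with hy₁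
  set y₂ : tomitaDomain K := ⟨η, mem_tomitaDomain_of_mem K hη⟩ with hy₂
  have key := structureFun_eq (DK := DK) h t (y₁ := y₁) (y₂ := y₂) (DK.J_mem_of_mem_symplComp ξ' hξ') hη s
  rw [structureFun, structureFun, DK.polarExt_ofReal, DK.polarExt_ofReal, DK.J_U,
    DK.polarExt_zero, DK.polarExt_zero, zero_add] at key
  simp only [hy₁, hy₂, DK.J_J, Submodule.coe_mk] at key
  rw [← ModularData.inner_appReal_right_eq DK.U s] at key
  -- `key : ⟪ξ', Δ^{is} W(h(s+t)) Δ^{-is} η⟫ = ⟪ξ', W(h t) η⟫`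
  rw [mul_apply_eq_comp, mul_apply_eq_comp, show ((s + t : ℝ) : ℂ) = (s : ℂ) + t by push_cast; ring]
  exact key

end HSM

/-! ### The composition law `W(s) W(h(t)) = W((2π)⁻¹ log(e^{2πs} + e^{2πt}))` -/

section Composition

variable {H : Type*} [NormedAddCommGroup H] [InnerProductSpace ℂ H] [CompleteSpace H]
variable {K V : StandardSubspace H} (DK : ModularData K) (DV : ModularData V)

/-- `Δ^{-is} Δ^{is} = 1` at the operator level. [folklore] -/
theorem appReal_neg_mul_appReal (U : OneParameterUnitaryGroup H) (s : ℝ) : U.appReal (-s) * U.appReal s = 1 := by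
  rw [← UnitaryRep.appReal_add, neg_add_cancel, UnitaryRep.appReal_zero]

/-- `Δ^{is} Δ^{-is} = 1` at the operator level. [folklore] -/
theorem appReal_mul_appReal_neg (U : OneParameterUnitaryGroup H) (s : ℝ) : U.appReal s * U.appReal (-s) = 1 := by
  rw [← UnitaryRep.appReal_add, add_neg_cancel, UnitaryRep.appReal_zero]

/-- (2.4.4) solved for `T(s + t)`: `W(h(s + t)) = Δ_K^{-is} W(h(t)) Δ_K^{is}`.
[cite: Longo2008LecturesConformalNets, Thm. 2.4.1 (proof, (2.4.4))] -/
theorem inclusionFamily_stripReparam_add (h : IsHalfSidedModularInclusion K V DV) (s t : ℝ) :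
    inclusionFamily DK DV h.le (stripReparam ((s + t : ℝ) : ℂ)) =
      DK.U.appReal (-s) * inclusionFamily DK DV h.le (stripReparam (t : ℂ)) * DK.U.appReal s := by
  rw [← U_mul_inclusionFamily_stripReparam_mul_U h s t]
  simp only [← mul_assoc, appReal_neg_mul_appReal, one_mul]
  rw [mul_assoc, appReal_neg_mul_appReal, mul_one]

/-- The real logarithm identity `log(e^{2πs} + e^{2πt}) = 2πs + log(1 + e^{2π(t-s)})`. [folklore] -/
theorem log_exp_add_exp (s t : ℝ) :
    Real.log (Real.exp (2 * π * s) + Real.exp (2 * π * t)) = 2 * π * s + Real.log (1 + Real.exp (2 * π * (t - s))) := by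
  have h1 : Real.exp (2 * π * s) + Real.exp (2 * π * t) =
      Real.exp (2 * π * s) * (1 + Real.exp (2 * π * (t - s))) := by
    rw [mul_add, mul_one, ← Real.exp_add]; ring_nf
  rw [h1, Real.log_mul (Real.exp_pos _).ne' (by positivity), Real.log_exp]

/-- **The composition law** (Longo, proof of Thm. 2.4.1: multiplying (2.4.4) "from the left by
`Δ_H^{-is}` and from the right by `Δ_K^{is}` … `= W((1/2π) log(e^{2πs} + e^{2πt}))`", which shows that
"the `W(t)`'s form a commutative family"). [cite: Longo2008LecturesConformalNets, Thm. 2.4.1 (proof)] -/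
theorem inclusionFamily_ofReal_mul_inclusionFamily_stripReparam (h : IsHalfSidedModularInclusion K V DV)
    (s t : ℝ) :
    inclusionFamily DK DV h.le s * inclusionFamily DK DV h.le (stripReparam (t : ℂ)) =
      inclusionFamily DK DV h.le (((2 * π)⁻¹ * Real.log (Real.exp (2 * π * s) + Real.exp (2 * π * t)) : ℝ) : ℂ) := by
  have h1 := inclusionFamily_stripReparam_add DK DV h s (t - s)
  rw [show s + (t - s) = t by ring] at h1
  have hmem : stripReparam ((t - s : ℝ) : ℂ) ∈ closedStrip 2⁻¹ :=
    stripReparam_mem_closedStrip (by rw [mem_closedStrip_iff, ofReal_im]; norm_num)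
  have h2 := inclusionFamily_add_ofReal DK DV h.le s hmem
  rw [inclusionFamily_ofReal, h1]
  calc DV.U.appReal (-s) * DK.U.appReal s *
        (DK.U.appReal (-s) * inclusionFamily DK DV h.le (stripReparam ((t - s : ℝ) : ℂ)) * DK.U.appReal s)
      = DV.U.appReal (-s) * (DK.U.appReal s * DK.U.appReal (-s)) *
          inclusionFamily DK DV h.le (stripReparam ((t - s : ℝ) : ℂ)) * DK.U.appReal s := by
        simp only [mul_assoc]
    _ = inclusionFamily DK DV h.le (stripReparam ((t - s : ℝ) : ℂ) + s) := by
        rw [appReal_mul_appReal_neg, mul_one, h2]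
    _ = _ := by
        rw [stripReparam_ofReal, ← ofReal_add, log_exp_add_exp]
        congr 2
        field_simp
        ring

/-! ### The local group `U₀(x) = W((2π)⁻¹ log(1 + x))`, `x > -1` -/

/-- The logarithmic coordinate `τ(x) = (2π)⁻¹ log(1 + x)` (`U(e^{2πt} − 1) = W(t)` inverted: `t = τ(x)`
for `x = e^{2πt} − 1`). [cite: Longo2008LecturesConformalNets, Thm. 2.4.1 (proof)] -/
def logCoord (x : ℝ) : ℝ := (2 * π)⁻¹ * Real.log (1 + x)

/-- `τ(0) = 0`. [folklore] -/
theorem logCoord_zero : logCoord 0 = 0 := by simp [logCoord]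

/-- `τ(e^{2πt} − 1) = t`. [folklore] -/
theorem logCoord_exp_sub_one (t : ℝ) : logCoord (Real.exp (2 * π * t) - 1) = t := by
  rw [logCoord, add_sub_cancel, Real.log_exp]; field_simp

/-- `e^{2π τ(x)} = 1 + x` for `x > -1`. [folklore] -/
theorem exp_two_pi_mul_logCoord {x : ℝ} (hx : -1 < x) : Real.exp (2 * π * logCoord x) = 1 + x := by
  rw [logCoord, ← mul_assoc, mul_inv_cancel₀ (by positivity), one_mul, Real.exp_log (by linarith)]

/-- **The local translation group** `U₀(x) = W(τ(x))`, `τ(x) = (2π)⁻¹ log(1 + x)`: Longo's "`U(e^{2πt} − 1) ≡ W(t)`"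
(Thm. 2.4.1, proof), a genuine one-parameter group law on `x > -1`; for `x ≤ -1` the value is a
junk unitary. [cite: Longo2008LecturesConformalNets, Thm. 2.4.1 (proof)] -/
def localGroup (hKV : K.toClosedSubmodule ≤ V.toClosedSubmodule) (x : ℝ) : H →L[ℂ] H :=
  inclusionFamily DK DV hKV (logCoord x : ℂ)

variable (hKV : K.toClosedSubmodule ≤ V.toClosedSubmodule)

/-- `U₀(x) = Δ_V^{-iτ(x)} Δ_K^{iτ(x)}`. [cite: Longo2008LecturesConformalNets, Thm. 2.4.1 (proof)] -/
theorem localGroup_eq (x : ℝ) :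
    localGroup DK DV hKV x = DV.U.appReal (-logCoord x) * DK.U.appReal (logCoord x) :=
  inclusionFamily_ofReal DK DV hKV _

/-- Each `U₀(x)` is unitary. [folklore] -/
theorem localGroup_mem_unitary (x : ℝ) : localGroup DK DV hKV x ∈ unitary (H →L[ℂ] H) := by
  rw [localGroup_eq]
  exact mul_mem (UnitaryRep.appReal_mem_unitary _ _) (UnitaryRep.appReal_mem_unitary _ _)

/-- `U₀(0) = 1`. [folklore] -/
theorem localGroup_zero : localGroup DK DV hKV 0 = 1 := by
  rw [localGroup, logCoord_zero, ofReal_zero, inclusionFamily_zero]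

/-- **`U₀(e^{2πt} − 1) = W(t) = Δ_V^{-it} Δ_K^{it}`** (the defining relation of Wiesbrock's
translations). [cite: Longo2008LecturesConformalNets, Thm. 2.4.1] -/
theorem localGroup_exp_sub_one (t : ℝ) :
    localGroup DK DV hKV (Real.exp (2 * π * t) - 1) = DV.U.appReal (-t) * DK.U.appReal t := by
  rw [localGroup_eq, logCoord_exp_sub_one]

/-- `‖U₀(x) v‖ = ‖v‖`. [folklore] -/
theorem norm_localGroup_apply (x : ℝ) (v : H) : ‖localGroup DK DV hKV x v‖ = ‖v‖ :=
  (localGroup DK DV hKV x).norm_map_of_mem_unitary (localGroup_mem_unitary DK DV hKV x) v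

/-- **The local group law for a positive increment**: `U₀(x + y) = U₀(x) U₀(y)` for `x > -1`, `y > 0`
(Longo: "`U(e^{2πt} − 1) U(e^{2πa} − 1) = U(e^{2π(t+a)} − 2)`, showing that `U` is additive for
positive arguments"). [cite: Longo2008LecturesConformalNets, Thm. 2.4.1 (proof)] -/
theorem localGroup_add_of_pos (h : IsHalfSidedModularInclusion K V DV) {x y : ℝ} (hx : -1 < x)
    (hy : 0 < y) : localGroup DK DV h.le (x + y) = localGroup DK DV h.le x * localGroup DK DV h.le y := by
  have key := inclusionFamily_ofReal_mul_inclusionFamily_stripReparam DK DV h (logCoord x) ((2 * π)⁻¹ * Real.log y)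
  have hy' : 2 * π * ((2 * π)⁻¹ * Real.log y) = Real.log y := by field_simp
  have hτy : stripReparam (((2 * π)⁻¹ * Real.log y : ℝ) : ℂ) = (logCoord y : ℂ) := by
    rw [stripReparam_ofReal, hy', Real.exp_log hy]; rfl
  have hc : (2 * π)⁻¹ * Real.log (Real.exp (2 * π * logCoord x) + Real.exp (2 * π * ((2 * π)⁻¹ * Real.log y))) =
      logCoord (x + y) := by
    rw [exp_two_pi_mul_logCoord hx, hy', Real.exp_log hy, logCoord, add_assoc]
  rw [hτy, hc] at key
  exact key.symm

/-- `U₀(y) U₀(-y) = 1` for `-1 < y < 0`. [cite: Longo2008LecturesConformalNets, Thm. 2.4.1 (proof)] -/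
theorem localGroup_mul_localGroup_neg_of_neg (h : IsHalfSidedModularInclusion K V DV) {y : ℝ} (hy₀ : -1 < y)
    (hy : y < 0) : localGroup DK DV h.le y * localGroup DK DV h.le (-y) = 1 := by
  rw [← localGroup_add_of_pos DK DV h hy₀ (neg_pos.2 hy), add_neg_cancel, localGroup_zero]

/-- `U₀(-y) U₀(y) = 1` for `0 < y < 1`. [cite: Longo2008LecturesConformalNets, Thm. 2.4.1 (proof)] -/
theorem localGroup_neg_mul_localGroup_of_pos (h : IsHalfSidedModularInclusion K V DV) {y : ℝ} (hy : 0 < y)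
    (hy₁ : y < 1) : localGroup DK DV h.le (-y) * localGroup DK DV h.le y = 1 := by
  rw [← localGroup_add_of_pos DK DV h (by linarith) hy, neg_add_cancel, localGroup_zero]

/-- **`U₀(-y) = U₀(y)^*` for `|y| < 1`** (a one-sided inverse of a unitary is its adjoint).
[cite: Longo2008LecturesConformalNets, Thm. 2.4.1 (proof)] -/
theorem localGroup_neg_eq_star (h : IsHalfSidedModularInclusion K V DV) {y : ℝ} (hy₀ : -1 < y) (hy₁ : y < 1) :
    localGroup DK DV h.le (-y) = star (localGroup DK DV h.le y) := by
  have hu := localGroup_mem_unitary DK DV h.le y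
  rcases lt_trichotomy y 0 with hy | rfl | hy
  · -- `U₀(y) U₀(-y) = 1`
    have h1 := localGroup_mul_localGroup_neg_of_neg DK DV h hy₀ hy
    calc localGroup DK DV h.le (-y) = (star (localGroup DK DV h.le y) * localGroup DK DV h.le y) *
          localGroup DK DV h.le (-y) := by rw [Unitary.star_mul_self_of_mem hu, one_mul]
      _ = star (localGroup DK DV h.le y) := by rw [mul_assoc, h1, mul_one]
  · rw [neg_zero, localGroup_zero, star_one]
  · have h1 := localGroup_neg_mul_localGroup_of_pos DK DV h hy hy₁
    calc localGroup DK DV h.le (-y) = localGroup DK DV h.le (-y) *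
          (localGroup DK DV h.le y * star (localGroup DK DV h.le y)) := by
            rw [Unitary.mul_star_self_of_mem hu, mul_one]
      _ = star (localGroup DK DV h.le y) := by rw [← mul_assoc, h1, one_mul]

/-- **The local group law** `U₀(x + y) = U₀(x) U₀(y)` whenever `x, y, x + y > -1` (Longo: "`U` is
additive for positive arguments hence … for any real arguments" — the extension by inverses).
[cite: Longo2008LecturesConformalNets, Thm. 2.4.1 (proof)] -/
theorem localGroup_add (h : IsHalfSidedModularInclusion K V DV) {x y : ℝ} (hx : -1 < x) (hy : -1 < y)
    (hxy : -1 < x + y) : localGroup DK DV h.le (x + y) = localGroup DK DV h.le x * localGroup DK DV h.le y := by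
  rcases lt_trichotomy y 0 with hy0 | rfl | hy0
  · -- `y < 0`: `U₀(x) = U₀(x + y) U₀(-y)` and `U₀(-y) = U₀(y)^*`
    have h1 : localGroup DK DV h.le x = localGroup DK DV h.le (x + y) * localGroup DK DV h.le (-y) := by
      rw [← localGroup_add_of_pos DK DV h hxy (neg_pos.2 hy0), add_neg_cancel_right]
    have h2 : star (localGroup DK DV h.le (-y)) = localGroup DK DV h.le y := by
      have := localGroup_neg_eq_star DK DV h (y := -y) (by linarith) (by linarith)
      rw [neg_neg] at this
      rw [← this]
    have hu := localGroup_mem_unitary DK DV h.le (-y)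
    calc localGroup DK DV h.le (x + y)
        = localGroup DK DV h.le (x + y) * (localGroup DK DV h.le (-y) * star (localGroup DK DV h.le (-y))) := by
          rw [Unitary.mul_star_self_of_mem hu, mul_one]
      _ = localGroup DK DV h.le x * localGroup DK DV h.le y := by rw [← mul_assoc, ← h1, h2]
  · rw [add_zero, localGroup_zero, mul_one]
  · exact localGroup_add_of_pos DK DV h hx hy0

/-- **The `U₀(x)` commute** (for `x, y > -1` with `x + y > -1`). [cite: Longo2008LecturesConformalNets, Thm. 2.4.1 (proof)] -/
theorem localGroup_comm (h : IsHalfSidedModularInclusion K V DV) {x y : ℝ} (hx : -1 < x) (hy : -1 < y)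
    (hxy : -1 < x + y) : localGroup DK DV h.le x * localGroup DK DV h.le y = localGroup DK DV h.le y * localGroup DK DV h.le x := by
  rw [← localGroup_add DK DV h hx hy hxy, add_comm, localGroup_add DK DV h hy hx (by linarith)]

/-- **Strong continuity of the local group on `(-1, ∞)`**. [folklore] -/
theorem continuousOn_localGroup_apply (v : H) : ContinuousOn (fun x => localGroup DK DV hKV x v) (Ioi (-1)) := by
  intro x hx
  have hx' : (-1 : ℝ) < x := hx
  have hτ : ContinuousAt logCoord x :=
    continuousAt_const.mul ((continuousAt_const.add continuousAt_id).log
      (show (1 : ℝ) + x ≠ 0 from by linarith))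
  simp only [localGroup_eq, mul_apply_eq_comp]
  have h1 : Tendsto (fun y => DK.U.appReal (logCoord y) v) (𝓝 x) (𝓝 (DK.U.appReal (logCoord x) v)) :=
    ((DK.U.continuous_appReal_apply v).continuousAt).tendsto.comp hτ
  have h2 : Tendsto (fun y => logCoord x - logCoord y) (𝓝 x) (𝓝 0) := by
    simpa using (tendsto_const_nhds (x := logCoord x)).sub hτ.tendsto
  have h3 := OneParameterGroup.tendsto_app_apply_of_tendsto DV.U.toStrongContRepresentation h2 h1
  -- `Δ_V^{-iτ(y)} w = Δ_V^{-iτ(x)} Δ_V^{i(τ(x) - τ(y))} w`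
  have h4 : ∀ y : ℝ, DV.U.appReal (-logCoord y) (DK.U.appReal (logCoord y) v) =
      DV.U.appReal (-logCoord x) (DV.U.appReal (logCoord x - logCoord y) (DK.U.appReal (logCoord y) v)) := by
    intro y
    rw [← mul_apply_eq_comp (DV.U.appReal (-logCoord x)), ← UnitaryRep.appReal_add]
    congr 2; ring
  simp only [UnitaryRep.app_toStrongContRepresentation] at h3
  refine ContinuousAt.continuousWithinAt ?_
  have h5 : Tendsto (fun y => DV.U.appReal (-logCoord x)
      (DV.U.appReal (logCoord x - logCoord y) (DK.U.appReal (logCoord y) v))) (𝓝 x)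
      (𝓝 (DV.U.appReal (-logCoord x) (DK.U.appReal (logCoord x) v))) :=
    ((DV.U.appReal (-logCoord x)).continuous.tendsto _).comp h3
  exact h5.congr fun y => (h4 y).symm

end Composition


/-! ### The translation group `U(x)`, `x ∈ ℝ` -/

section Group

variable {H : Type*} [NormedAddCommGroup H] [InnerProductSpace ℂ H] [CompleteSpace H]
variable {K V : StandardSubspace H} (DK : ModularData K) (DV : ModularData V)
  (hKV : K.toClosedSubmodule ≤ V.toClosedSubmodule)

/-- The local group as unitaries. [cite: Longo2008LecturesConformalNets, Thm. 2.4.1 (proof)] -/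
def localUnitary (x : ℝ) : unitary (H →L[ℂ] H) := ⟨localGroup DK DV hKV x, localGroup_mem_unitary DK DV hKV x⟩

/-- Coercion of `localUnitary`. [folklore] -/
@[simp]
theorem coe_localUnitary (x : ℝ) : (localUnitary DK DV hKV x : H →L[ℂ] H) = localGroup DK DV hKV x := rfl

/-- **Wiesbrock's translations** `U(x)`, `x ∈ ℝ`: the one-parameter group extending the local group,
`U(x) = U₀(1)^⌊x⌋ U₀(x − ⌊x⌋)` (Longo: "`U` is additive for positive arguments hence, by analytic
continuation, for any real arguments. Thus `U` is a continuous one-parameter group of unitaries").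
[cite: Longo2008LecturesConformalNets, Thm. 2.4.1 (proof)] -/
def translationUnitary (x : ℝ) : unitary (H →L[ℂ] H) :=
  localUnitary DK DV hKV 1 ^ (⌊x⌋ : ℤ) * localUnitary DK DV hKV (Int.fract x)

variable {DK DV}

/-- The local law in the unitary group. [cite: Longo2008LecturesConformalNets, Thm. 2.4.1 (proof)] -/
theorem localUnitary_add (h : IsHalfSidedModularInclusion K V DV) {x y : ℝ} (hx : -1 < x) (hy : -1 < y)
    (hxy : -1 < x + y) :
    localUnitary DK DV h.le (x + y) = localUnitary DK DV h.le x * localUnitary DK DV h.le y :=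
  Subtype.ext (localGroup_add DK DV h hx hy hxy)

/-- `U₀(0) = 1` in the unitary group. [folklore] -/
theorem localUnitary_zero : localUnitary DK DV hKV 0 = 1 := Subtype.ext (localGroup_zero DK DV hKV)

/-- `U₀(1)` commutes with `U₀(f)`, `f > -1`. [cite: Longo2008LecturesConformalNets, Thm. 2.4.1 (proof)] -/
theorem commute_localUnitary_one (h : IsHalfSidedModularInclusion K V DV) {f : ℝ} (hf : -1 < f) :
    Commute (localUnitary DK DV h.le 1) (localUnitary DK DV h.le f) :=
  Subtype.ext (localGroup_comm DK DV h (by norm_num) hf (by linarith))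

/-- `U₀(1)^n U₀(f) = U₀(n + f)` for `n ∈ ℕ`, `f > -1`. [cite: Longo2008LecturesConformalNets, Thm. 2.4.1 (proof)] -/
theorem localUnitary_one_pow_mul (h : IsHalfSidedModularInclusion K V DV) (n : ℕ) {f : ℝ} (hf : -1 < f) :
    localUnitary DK DV h.le 1 ^ n * localUnitary DK DV h.le f = localUnitary DK DV h.le (n + f) := by
  induction n with
  | zero => simp
  | succ k ih =>
    have hk : (0 : ℝ) ≤ k := k.cast_nonneg
    rw [pow_succ', mul_assoc, ih, ← localUnitary_add h (by norm_num) (by linarith) (by linarith)]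
    congr 1; push_cast; ring

/-- **`U = U₀` on `(-1, ∞)`**. [cite: Longo2008LecturesConformalNets, Thm. 2.4.1 (proof)] -/
theorem translationUnitary_eq_localUnitary (h : IsHalfSidedModularInclusion K V DV) {x : ℝ} (hx : -1 < x) :
    translationUnitary DK DV h.le x = localUnitary DK DV h.le x := by
  rw [translationUnitary]
  have hf0 : 0 ≤ Int.fract x := Int.fract_nonneg x
  have hf1 : Int.fract x < 1 := Int.fract_lt_one x
  have hfl : (-1 : ℤ) ≤ ⌊x⌋ := by
    rw [Int.le_floor]; push_cast; exact hx.le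
  rcases hfl.eq_or_lt with hm | hm
  · -- `⌊x⌋ = -1`: `U₀(1)⁻¹ U₀(x + 1) = U₀(x)`
    rw [← hm, zpow_neg, zpow_one]
    have hx1 : Int.fract x = x + 1 := by
      rw [Int.fract, ← hm]; push_cast; ring
    rw [hx1, inv_mul_eq_iff_eq_mul, ← localUnitary_add h (by norm_num) hx (by linarith), add_comm]
  · -- `⌊x⌋ = n ≥ 0`
    obtain ⟨n, hn⟩ : ∃ n : ℕ, (⌊x⌋ : ℤ) = n := ⟨(⌊x⌋).toNat, (Int.toNat_of_nonneg (by omega)).symm⟩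
    rw [hn, zpow_natCast, localUnitary_one_pow_mul h n (by linarith)]
    congr 1
    have h1 := Int.floor_add_fract x
    have h2 : ((⌊x⌋ : ℤ) : ℝ) = (n : ℝ) := by rw [hn, Int.cast_natCast]
    linarith

/-- **The group law** `U(x + y) = U(x) U(y)` for all real `x, y`. [cite: Longo2008LecturesConformalNets, Thm. 2.4.1 (proof)] -/
theorem translationUnitary_add (h : IsHalfSidedModularInclusion K V DV) (x y : ℝ) :
    translationUnitary DK DV h.le (x + y) = translationUnitary DK DV h.le x * translationUnitary DK DV h.le y := by
  set A := localUnitary DK DV h.le 1 with hA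
  set f := Int.fract x with hf
  set g := Int.fract y with hg
  have hf0 : 0 ≤ f := Int.fract_nonneg x
  have hf1 : f < 1 := Int.fract_lt_one x
  have hg0 : 0 ≤ g := Int.fract_nonneg y
  have hg1 : g < 1 := Int.fract_lt_one y
  have hxd : x = ⌊x⌋ + f := (Int.floor_add_fract x).symm
  have hyd : y = ⌊y⌋ + g := (Int.floor_add_fract y).symm
  -- `U(x) U(y) = A^(⌊x⌋ + ⌊y⌋) U₀(f + g)`
  have hprod : translationUnitary DK DV h.le x * translationUnitary DK DV h.le y =
      A ^ (⌊x⌋ + ⌊y⌋ : ℤ) * localUnitary DK DV h.le (f + g) := by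
    rw [translationUnitary, translationUnitary, ← hA, ← hf, ← hg,
      localUnitary_add h (by linarith) (by linarith) (by linarith), zpow_add]
    have hc : Commute (A ^ (⌊y⌋ : ℤ)) (localUnitary DK DV h.le f) :=
      ((commute_localUnitary_one h (by linarith)).zpow_left ⌊y⌋)
    calc A ^ ⌊x⌋ * localUnitary DK DV h.le f * (A ^ ⌊y⌋ * localUnitary DK DV h.le g)
        = A ^ ⌊x⌋ * (localUnitary DK DV h.le f * A ^ ⌊y⌋) * localUnitary DK DV h.le g := by
          simp only [mul_assoc]
      _ = A ^ ⌊x⌋ * (A ^ ⌊y⌋ * localUnitary DK DV h.le f) * localUnitary DK DV h.le g := by rw [hc.eq]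
      _ = A ^ ⌊x⌋ * A ^ ⌊y⌋ * (localUnitary DK DV h.le f * localUnitary DK DV h.le g) := by
          simp only [mul_assoc]
  rw [hprod, translationUnitary, ← hA]
  by_cases hlt : f + g < 1
  · -- no carry
    have hfloor : ⌊x + y⌋ = ⌊x⌋ + ⌊y⌋ := by
      rw [Int.floor_eq_iff]; push_cast; constructor <;> linarith
    have hfract : Int.fract (x + y) = f + g := by
      rw [Int.fract, hfloor]; push_cast; linarith
    rw [hfloor, hfract]
  · -- carry
    push Not at hlt
    have hfloor : ⌊x + y⌋ = ⌊x⌋ + ⌊y⌋ + 1 := by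
      rw [Int.floor_eq_iff]; push_cast; constructor <;> linarith
    have hfract : Int.fract (x + y) = f + g - 1 := by
      rw [Int.fract, hfloor]; push_cast; linarith
    rw [hfloor, hfract, zpow_add_one]
    have h1 : localUnitary DK DV h.le (f + g) = A * localUnitary DK DV h.le (f + g - 1) := by
      rw [hA, ← localUnitary_add h (by norm_num) (by linarith) (by linarith)]
      congr 1; ring
    rw [h1, ← mul_assoc]

/-- `U(0) = 1`. [folklore] -/
theorem translationUnitary_zero (h : IsHalfSidedModularInclusion K V DV) : translationUnitary DK DV h.le 0 = 1 := by
  rw [translationUnitary_eq_localUnitary h (by norm_num), localUnitary_zero]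

/-- **Strong continuity of `x ↦ U(x) v`**. [cite: Longo2008LecturesConformalNets, Thm. 2.4.1 (proof)] -/
theorem continuous_translationUnitary_apply (h : IsHalfSidedModularInclusion K V DV) (v : H) :
    Continuous fun x : ℝ => (translationUnitary DK DV h.le x : H →L[ℂ] H) v := by
  refine continuous_iff_continuousAt.2 fun x₀ => ?_
  -- near `x₀`: `U(x) v = U₀(x - ⌊x₀⌋) (U(⌊x₀⌋) v)`
  set k : ℝ := (⌊x₀⌋ : ℝ) with hk
  have hev : ∀ᶠ x in 𝓝 x₀, (translationUnitary DK DV h.le x : H →L[ℂ] H) v =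
      localGroup DK DV h.le (x - k) ((translationUnitary DK DV h.le k : H →L[ℂ] H) v) := by
    have : ∀ᶠ x in 𝓝 x₀, k - 1 < x := Ioi_mem_nhds (by rw [hk]; linarith [Int.floor_le x₀])
    filter_upwards [this] with x hx
    have h1 : translationUnitary DK DV h.le x = translationUnitary DK DV h.le (x - k) * translationUnitary DK DV h.le k := by
      rw [← translationUnitary_add h, sub_add_cancel]
    rw [h1, translationUnitary_eq_localUnitary h (by linarith), Submonoid.coe_mul, coe_localUnitary, mul_apply_eq_comp]
  refine (ContinuousAt.congr ?_ (EventuallyEq.symm hev) : ContinuousAt _ x₀)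
  have hcont := continuousOn_localGroup_apply DK DV h.le ((translationUnitary DK DV h.le k : H →L[ℂ] H) v)
  have hx₀ : x₀ - k ∈ Ioi (-1 : ℝ) := by
    show (-1 : ℝ) < x₀ - k
    rw [hk]; linarith [Int.floor_le x₀, Int.lt_floor_add_one x₀]
  exact (hcont.continuousAt (Ioi_mem_nhds hx₀)).comp (f := fun x : ℝ => x - k) (x := x₀)
    (continuous_sub_right k).continuousAt

/-- `U` as a monoid homomorphism on `Multiplicative ℝ`. [folklore] -/
def translationHom (h : IsHalfSidedModularInclusion K V DV) : Multiplicative ℝ →* (H →L[ℂ] H) where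
  toFun g := (translationUnitary DK DV h.le (Multiplicative.toAdd g) : H →L[ℂ] H)
  map_one' := by rw [toAdd_one, translationUnitary_zero h, OneMemClass.coe_one]
  map_mul' a b := by rw [toAdd_mul, translationUnitary_add h, Submonoid.coe_mul]

/-- **Wiesbrock's translation group as a strongly continuous one-parameter unitary group** (the `T`
of `Wiesbrock_oneParticle`). [cite: Longo2008LecturesConformalNets, Thm. 2.4.1] -/
def translationGroup (h : IsHalfSidedModularInclusion K V DV) : OneParameterUnitaryGroup H where
  toMonoidHom := translationHom (DK := DK) h
  strongly_continuous v := (continuous_translationUnitary_apply (DK := DK) h v).comp continuous_toAdd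
  mem_unitary g := (translationUnitary DK DV h.le (Multiplicative.toAdd g)).2

/-- `(translationGroup h).appReal x = U(x)`. [folklore] -/
theorem translationGroup_appReal (h : IsHalfSidedModularInclusion K V DV) (x : ℝ) :
    (translationGroup (DK := DK) h).appReal x = (translationUnitary DK DV h.le x : H →L[ℂ] H) := rfl

/-- **`U(x) = U₀(x) = W(τ(x))` for `x > -1`**. [cite: Longo2008LecturesConformalNets, Thm. 2.4.1 (proof)] -/
theorem translationGroup_appReal_eq_localGroup (h : IsHalfSidedModularInclusion K V DV) {x : ℝ} (hx : -1 < x) :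
    (translationGroup (DK := DK) h).appReal x = localGroup DK DV h.le x := by
  rw [translationGroup_appReal, translationUnitary_eq_localUnitary h hx, coe_localUnitary]

/-- **The defining relation `U(e^{2πt} − 1) = Δ_V^{-it} Δ_K^{it}`** (Longo Thm. 2.4.1: "The translation
unitaries `U(t)` are defined by `U(e^{2πt} − 1) = Δ_H^{-it} Δ_K^{it}`"). [cite: Longo2008LecturesConformalNets, Thm. 2.4.1] -/
theorem translationGroup_appReal_exp_sub_one (h : IsHalfSidedModularInclusion K V DV) (t : ℝ) :
    (translationGroup (DK := DK) h).appReal (Real.exp (2 * π * t) - 1) = DV.U.appReal (-t) * DK.U.appReal t := by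
  rw [translationGroup_appReal_eq_localGroup h (by linarith [Real.exp_pos (2 * π * t)]), localGroup_exp_sub_one]

end Group

/-! ### Dilation covariance `Δ_V^{-it} U(x) Δ_V^{it} = U(e^{2πt} x)` -/

section Covariance

variable {H : Type*} [NormedAddCommGroup H] [InnerProductSpace ℂ H] [CompleteSpace H]
variable {K V : StandardSubspace H} (DK : ModularData K) {DV : ModularData V}

/-- **Covariance for `x > -1`** from the covariance `W(a + t) = Δ_V^{-it} W(a) Δ_K^{it}` of the strip
family (Longo (2.4.6): "`Δ_H^{-it} U(s) Δ_H^{it} = (Δ_H^{-it} Δ_K^{it}) Δ_K^{-it} U(s) Δ_K^{it} (Δ_K^{-it} Δ_H^{it})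
= U(1 − e^{2πt}) U(e^{2πt}s) U(1 − e^{2πt})^* = U(e^{2πt}s)`"). [cite: Longo2008LecturesConformalNets, Thm. 2.4.1 (2.4.6)] -/
theorem U_neg_mul_translation_mul_U_of_gt (h : IsHalfSidedModularInclusion K V DV) {x : ℝ} (hx : -1 < x) (t : ℝ) :
    DV.U.appReal (-t) * (translationGroup (DK := DK) h).appReal x * DV.U.appReal t =
      (translationGroup (DK := DK) h).appReal (Real.exp (2 * π * t) * x) := by
  set T := translationGroup (DK := DK) h with hT
  set a := logCoord x with ha
  have hxa : Real.exp (2 * π * a) = 1 + x := exp_two_pi_mul_logCoord hx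
  have hW : T.appReal x = inclusionFamily DK DV h.le (a : ℂ) := translationGroup_appReal_eq_localGroup h hx
  have hmem : (a : ℂ) ∈ closedStrip 2⁻¹ := by rw [mem_closedStrip_iff, ofReal_im]; norm_num
  have hcov := inclusionFamily_add_ofReal DK DV h.le t hmem
  have h1 : DV.U.appReal (-t) * inclusionFamily DK DV h.le (a : ℂ) =
      inclusionFamily DK DV h.le ((a : ℂ) + t) * DK.U.appReal (-t) := by
    rw [hcov, mul_assoc, appReal_mul_appReal_neg, mul_one]
  have h2 : DK.U.appReal (-t) * DV.U.appReal t = T.appReal (-(Real.exp (2 * π * t) - 1)) := by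
    rw [← star_appReal T, translationGroup_appReal_exp_sub_one h t, star_mul, star_appReal, star_appReal, neg_neg]
  have h3 : inclusionFamily DK DV h.le ((a : ℂ) + t) = T.appReal (Real.exp (2 * π * (a + t)) - 1) := by
    rw [translationGroup_appReal_exp_sub_one h, ← ofReal_add, inclusionFamily_ofReal]
  calc DV.U.appReal (-t) * T.appReal x * DV.U.appReal t
      = inclusionFamily DK DV h.le ((a : ℂ) + t) * (DK.U.appReal (-t) * DV.U.appReal t) := by
        rw [hW, h1, mul_assoc]
    _ = T.appReal (Real.exp (2 * π * (a + t)) - 1 + -(Real.exp (2 * π * t) - 1)) := by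
        rw [h2, h3, ← UnitaryRep.appReal_add]
    _ = T.appReal (Real.exp (2 * π * t) * x) := by
        congr 1
        rw [show 2 * π * (a + t) = 2 * π * a + 2 * π * t by ring, Real.exp_add, hxa]
        ring

/-- **Dilation covariance** `Δ_V^{-it} U(x) Δ_V^{it} = U(e^{2πt} x)` for all real `x`, `t` (Longo
Thm. 2.4.1, (2.4.6): "`Δ_H^{-it} U(s) Δ_H^{it} = U(e^{2πt}s)`", so that with the dilations `V` is a
representation of the translation-dilation group). [cite: Longo2008LecturesConformalNets, Thm. 2.4.1 (2.4.6)] -/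
theorem U_neg_mul_translation_mul_U (h : IsHalfSidedModularInclusion K V DV) (t x : ℝ) :
    DV.U.appReal (-t) * (translationGroup (DK := DK) h).appReal x * DV.U.appReal t =
      (translationGroup (DK := DK) h).appReal (Real.exp (2 * π * t) * x) := by
  set T := translationGroup (DK := DK) h with hT
  -- `x = (x + n) - n` with `x + n > -1`
  obtain ⟨n, hn⟩ : ∃ n : ℕ, -1 < x + n := ⟨⌈-x⌉₊, by linarith [Nat.le_ceil (-x)]⟩
  have hn' : (-1 : ℝ) < n := by linarith [(n : ℕ).cast_nonneg (α := ℝ)]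
  have hsplit : T.appReal x = T.appReal (x + n) * star (T.appReal n) := by
    rw [star_appReal, ← UnitaryRep.appReal_add, add_neg_cancel_right]
  have hmid : DV.U.appReal t * DV.U.appReal (-t) = 1 := appReal_mul_appReal_neg DV.U t
  have e1 := U_neg_mul_translation_mul_U_of_gt DK h hn t
  have e2 := U_neg_mul_translation_mul_U_of_gt DK h hn' t
  have e2' : DV.U.appReal (-t) * star (T.appReal n) * DV.U.appReal t = star (T.appReal (Real.exp (2 * π * t) * n)) := by
    rw [← e2, star_mul, star_mul, star_appReal, star_appReal, star_appReal, neg_neg, mul_assoc]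
  calc DV.U.appReal (-t) * T.appReal x * DV.U.appReal t
      = (DV.U.appReal (-t) * T.appReal (x + n) * DV.U.appReal t) *
          (DV.U.appReal (-t) * star (T.appReal n) * DV.U.appReal t) := by
        rw [hsplit]
        calc DV.U.appReal (-t) * (T.appReal (x + ↑n) * star (T.appReal ↑n)) * DV.U.appReal t
            = DV.U.appReal (-t) * T.appReal (x + ↑n) * (DV.U.appReal t * DV.U.appReal (-t)) *
                star (T.appReal ↑n) * DV.U.appReal t := by rw [hmid, mul_one]; simp only [mul_assoc]
          _ = _ := by simp only [mul_assoc]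
    _ = T.appReal (Real.exp (2 * π * t) * (x + n)) * star (T.appReal (Real.exp (2 * π * t) * n)) := by rw [e1, e2']
    _ = T.appReal (Real.exp (2 * π * t) * x) := by
        rw [star_appReal, ← UnitaryRep.appReal_add]; congr 1; ring

/-- Covariance rearranged: `Δ_V^{it} U(x) = U(e^{-2πt} x) Δ_V^{it}`. [cite: Longo2008LecturesConformalNets, Thm. 2.4.1 (2.4.6)] -/
theorem U_mul_translation (h : IsHalfSidedModularInclusion K V DV) (t x : ℝ) :
    DV.U.appReal t * (translationGroup (DK := DK) h).appReal x =
      (translationGroup (DK := DK) h).appReal (Real.exp (-(2 * π * t)) * x) * DV.U.appReal t := by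
  have e := U_neg_mul_translation_mul_U DK h (-t) x
  rw [neg_neg, show 2 * π * -t = -(2 * π * t) by ring] at e
  rw [← e, mul_assoc, appReal_neg_mul_appReal, mul_one]

end Covariance

/-! ### `K = U(1) V` and `U(s) V ⊆ V` for `s ≥ 0` -/

section Geometry

variable {H : Type*} [NormedAddCommGroup H] [InnerProductSpace ℂ H] [CompleteSpace H]
variable {K V : StandardSubspace H} (DK : ModularData K) {DV : ModularData V}

/-- **`U(x) K ⊆ V` for `x ≥ -1`** (Longo (2.4.7): "`U(s)K ⊂ H`, `s ≥ −1`", for `s > -1` from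
`Δ_H^{-it} Δ_K^{it} K = Δ_H^{-it} K ⊂ H`, at `s = -1` by continuity). [cite: Longo2008LecturesConformalNets, Thm. 2.4.1 (2.4.7)] -/
theorem translation_apply_mem_V (h : IsHalfSidedModularInclusion K V DV) {x : ℝ} (hx : -1 ≤ x) {k : H}
    (hk : k ∈ K.toClosedSubmodule) : (translationGroup (DK := DK) h).appReal x k ∈ V.toClosedSubmodule := by
  have hgt : ∀ y : ℝ, -1 < y → (translationGroup (DK := DK) h).appReal y k ∈ V.toClosedSubmodule := by
    intro y hy
    rw [translationGroup_appReal_eq_localGroup h hy, localGroup_eq, mul_apply_eq_comp]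
    exact DV.U_mem _ _ (h.le (DK.U_mem _ _ hk))
  rcases hx.eq_or_lt with rfl | hlt
  · refine V.toClosedSubmodule.isClosed.mem_of_tendsto (b := 𝓝[>] (-1 : ℝ))
      (((continuous_translationUnitary_apply (DK := DK) h k).tendsto (-1)).mono_left nhdsWithin_le_nhds) ?_
    filter_upwards [self_mem_nhdsWithin] with y hy using hgt y hy
  · exact hgt x hlt

/-- **`Δ_V^{it} U(-1) = U(-1) Δ_K^{it}`** (Longo (2.4.8): "`Δ_H^{it} U(1) H = U(1) Δ_H^{it} U(−1) … = Δ_K^{it} K`";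
here as the operator identity obtained from covariance and `Δ_V^{it} = U(e^{-2πt} − 1) Δ_K^{it}`).
[cite: Longo2008LecturesConformalNets, Thm. 2.4.1 (2.4.8)] -/
theorem U_mul_translation_neg_one (h : IsHalfSidedModularInclusion K V DV) (t : ℝ) :
    DV.U.appReal t * (translationGroup (DK := DK) h).appReal (-1) =
      (translationGroup (DK := DK) h).appReal (-1) * DK.U.appReal t := by
  set T := translationGroup (DK := DK) h with hT
  have h1 : DV.U.appReal t = T.appReal (Real.exp (-(2 * π * t)) - 1) * DK.U.appReal t := by
    have e := translationGroup_appReal_exp_sub_one (DK := DK) h (-t)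
    rw [neg_neg, show 2 * π * -t = -(2 * π * t) by ring] at e
    rw [e, mul_assoc, appReal_neg_mul_appReal, mul_one]
  rw [U_mul_translation DK h t (-1), mul_neg_one]
  conv_lhs => rw [h1]
  rw [← mul_assoc, ← UnitaryRep.appReal_add]
  congr 2; ring

omit [CompleteSpace H] in
/-- A bounded linear map taking `K` into `V` maps `D(S_K)` into `D(S_V)` and intertwines the Tomita
operators. [folklore] -/
theorem tomitaOperator_map {A : H →L[ℂ] H} (hA : ∀ k ∈ K.toClosedSubmodule, A k ∈ V.toClosedSubmodule)
    (y : tomitaDomain K) :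
    ∃ hy : A y ∈ tomitaDomain V, tomitaOperator V ⟨A y, hy⟩ = A (tomitaOperator K y) := by
  obtain ⟨v, hv, w, hw, hy⟩ := y.2
  have hAy : A v + I • A w = A y := by rw [← hy, map_add, map_smul]
  refine ⟨hAy ▸ add_I_smul_mem_tomitaDomain V (hA v hv) (hA w hw), ?_⟩
  rw [tomitaOperator_apply_eq _ (hA v hv) (hA w hw) hAy, tomitaOperator_apply_eq y hv hw hy, map_sub, map_smul]

/-- **`U(1) J_V U(-1) = J_K`** (Longo (2.4.8) `K = U(1)H` gives `J_K = U(1) J_H U(−1)`; here proved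
BEFORE `K = U(1)H`, from `Δ_V^{it} U(−1) = U(−1) Δ_K^{it}` and the uniqueness of the polar continuation
`Δ^{-iz} y`, `Δ^{1/2} y = J S y`). [cite: Longo2008LecturesConformalNets, Thm. 2.4.1 (2.4.8)] -/
theorem translation_one_J_translation_neg_one (h : IsHalfSidedModularInclusion K V DV) (v : H) :
    (translationGroup (DK := DK) h).appReal 1 (DV.J ((translationGroup (DK := DK) h).appReal (-1) v)) = DK.J v := by
  set T := translationGroup (DK := DK) h with hT
  have hA : ∀ k ∈ K.toClosedSubmodule, T.appReal (-1) k ∈ V.toClosedSubmodule :=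
    fun k hk => translation_apply_mem_V DK h le_rfl hk
  have hTT : ∀ w : H, T.appReal 1 (T.appReal (-1) w) = w := fun w => by
    rw [← mul_apply_eq_comp, ← UnitaryRep.appReal_add, add_neg_cancel, UnitaryRep.appReal_zero, one_apply_eq_self]
  -- Step 1: on `S_K D(S_K) = D(S_K)`
  have hD : ∀ y : tomitaDomain K, T.appReal 1 (DV.J (T.appReal (-1) (tomitaOperator K y))) = DK.J (tomitaOperator K y) := by
    intro y
    obtain ⟨hy, hSy⟩ := tomitaOperator_map (K := K) (V := V) hA y
    -- the transported continuation `z ↦ U(1) Δ_V^{-iz} U(-1) y`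
    have hG := DK.eq_polarExt_of_forall_ofReal y (G := fun z => T.appReal 1 (DV.polarExt ⟨T.appReal (-1) y, hy⟩ z))
      ((T.appReal 1).continuous.comp_continuousOn (DV.continuousOn_polarExt _))
      ((T.appReal 1).differentiable.comp_differentiableOn (DV.differentiableOn_polarExt _))
      ⟨‖T.appReal (-1) (y : H)‖ + ‖tomitaOperator V ⟨T.appReal (-1) y, hy⟩‖, fun z _ => by
        rw [UnitaryRep.norm_appReal]; exact DV.norm_polarExt_le _ z⟩
      (fun t => by
        rw [DV.polarExt_ofReal, Submodule.coe_mk, ← mul_apply_eq_comp (DV.U.appReal (-t)),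
          U_mul_translation_neg_one DK h (-t), mul_apply_eq_comp, hTT])
      half_I_mem_closedStrip
    beta_reduce at hG
    have hSy' : tomitaOperator V (⟨T.appReal (-1) y, hy⟩ : tomitaDomain V) = T.appReal (-1) (tomitaOperator K y) := hSy
    rw [DV.polarExt_half_I, DK.polarExt_half_I, hSy'] at hG
    exact hG
  -- Step 2: density
  have hdense : ∀ w ∈ (tomitaDomain K : Set H), T.appReal 1 (DV.J (T.appReal (-1) w)) = DK.J w := by
    intro w hw
    have h1 := hD ⟨tomitaOperator K ⟨w, hw⟩, tomitaOperator_mem_domain ⟨w, hw⟩⟩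
    have h2 : tomitaOperator K (⟨tomitaOperator K ⟨w, hw⟩, tomitaOperator_mem_domain ⟨w, hw⟩⟩ : tomitaDomain K) = w :=
      tomitaOperator_tomitaOperator ⟨w, hw⟩
    rw [h2] at h1
    exact h1
  have hcont : Continuous fun w : H => T.appReal 1 (DV.J (T.appReal (-1) w)) :=
    (T.appReal 1).continuous.comp (DV.J.continuous.comp (T.appReal (-1)).continuous)
  exact congrFun (Continuous.ext_on (dense_tomitaDomain K) hcont DK.J.continuous hdense) v

/-- `J_V U(-1) = U(-1) J_K`. [cite: Longo2008LecturesConformalNets, Thm. 2.4.1 (2.4.8)] -/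
theorem J_translation_neg_one (h : IsHalfSidedModularInclusion K V DV) (v : H) :
    DV.J ((translationGroup (DK := DK) h).appReal (-1) v) = (translationGroup (DK := DK) h).appReal (-1) (DK.J v) := by
  rw [← translation_one_J_translation_neg_one DK h v, ← mul_apply_eq_comp, ← UnitaryRep.appReal_add,
    neg_add_cancel, UnitaryRep.appReal_zero, one_apply_eq_self]

/-- **`U(-1) K' ⊆ V'`**. [cite: Longo2008LecturesConformalNets, Thm. 2.4.1 (2.4.8)] -/
theorem translation_neg_one_apply_mem_symplComp (h : IsHalfSidedModularInclusion K V DV) {x : H}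
    (hx : x ∈ K.symplComp.toClosedSubmodule) :
    (translationGroup (DK := DK) h).appReal (-1) x ∈ V.symplComp.toClosedSubmodule := by
  have h1 : (translationGroup (DK := DK) h).appReal (-1) x =
      DV.J ((translationGroup (DK := DK) h).appReal (-1) (DK.J x)) := by
    rw [J_translation_neg_one DK h, DK.J_J]
  rw [h1]
  exact DV.J_mem _ (translation_apply_mem_V DK h le_rfl (DK.J_mem_of_mem_symplComp x hx))

/-- **`U(1) V ⊆ K`** (Longo (2.4.8), `K = U(1)H`, the inclusion `⊇`, there by Prop. 2.1.10; here by
duality from `U(−1) K' ⊆ V'`). [cite: Longo2008LecturesConformalNets, Thm. 2.4.1 (2.4.8)] -/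
theorem translation_one_apply_mem (h : IsHalfSidedModularInclusion K V DV) {v : H} (hv : v ∈ V.toClosedSubmodule) :
    (translationGroup (DK := DK) h).appReal 1 v ∈ K.toClosedSubmodule := by
  set T := translationGroup (DK := DK) h with hT
  rw [← mem_symplComp_symplComp_iff K, mem_symplComp_iff']
  intro y hy
  have h1 : ⟪y, T.appReal 1 v⟫_ℂ = ⟪T.appReal (-1) y, v⟫_ℂ := by
    rw [← T.inner_map_map (Multiplicative.ofAdd (-1 : ℝ)) y (T.appReal 1 v)]
    change ⟪T.appReal (-1) y, T.appReal (-1) (T.appReal 1 v)⟫_ℂ = _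
    rw [← mul_apply_eq_comp, ← UnitaryRep.appReal_add, neg_add_cancel, UnitaryRep.appReal_zero, one_apply_eq_self]
  rw [h1]
  exact im_inner_eq_zero_of_mem_symplComp_of_mem V (translation_neg_one_apply_mem_symplComp DK h hy) hv

/-- **`K = U(1) V`** (Longo Thm. 2.4.1: "`K = U(1)H`", eq. (2.4.8)). [cite: Longo2008LecturesConformalNets, Thm. 2.4.1 (2.4.8)] -/
theorem mem_iff_exists_translation_one (h : IsHalfSidedModularInclusion K V DV) (x : H) :
    x ∈ K.toClosedSubmodule ↔ ∃ y ∈ V.toClosedSubmodule, (translationGroup (DK := DK) h).appReal 1 y = x := by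
  set T := translationGroup (DK := DK) h with hT
  constructor
  · intro hx
    refine ⟨T.appReal (-1) x, translation_apply_mem_V DK h le_rfl hx, ?_⟩
    rw [← mul_apply_eq_comp, ← UnitaryRep.appReal_add, add_neg_cancel, UnitaryRep.appReal_zero, one_apply_eq_self]
  · rintro ⟨y, hy, rfl⟩
    exact translation_one_apply_mem DK h hy

/-- **`U(s) V ⊆ V` for `s ≥ 0`** (Longo Thm. 2.4.1: "`U(s)H = U(−1)U(s)U(1)H = U(−1)U(s)K ⊂ U(−1)K = H`").
[cite: Longo2008LecturesConformalNets, Thm. 2.4.1] -/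
theorem translation_apply_mem_V_of_nonneg (h : IsHalfSidedModularInclusion K V DV) {s : ℝ} (hs : 0 ≤ s) {v : H}
    (hv : v ∈ V.toClosedSubmodule) : (translationGroup (DK := DK) h).appReal s v ∈ V.toClosedSubmodule := by
  have h1 : (translationGroup (DK := DK) h).appReal s v =
      (translationGroup (DK := DK) h).appReal (s - 1) ((translationGroup (DK := DK) h).appReal 1 v) := by
    rw [← mul_apply_eq_comp, ← UnitaryRep.appReal_add, sub_add_cancel]
  rw [h1]
  exact translation_apply_mem_V DK h (by linarith) (translation_one_apply_mem DK h hv)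

end Geometry

/-! ### Positivity of the generator (Longo: "`U` allows a strongly continuous extension in the upper
half plane, analytic in `Im z > 0` and norm bounded by `1`. Consequently `U(s) = e^{isP}` for some
positive selfadjoint operator `P`") -/

section Extension

variable {H : Type*} [NormedAddCommGroup H] [InnerProductSpace ℂ H] [CompleteSpace H]
variable {K V : StandardSubspace H} (DK : ModularData K) (DV : ModularData V)
  (hKV : K.toClosedSubmodule ≤ V.toClosedSubmodule)

/-- **The analytic extension `Ũ(σ) = W((2π)⁻¹ log(1 + σ))`** of the translations to the closed
upper half-plane (off `σ = -1`), the strip family read in the coordinate `σ = e^{2πz} − 1`.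
[cite: Longo2008LecturesConformalNets, Thm. 2.4.1 (proof, (2.4.5))] -/
def translationExt (σ : ℂ) : H →L[ℂ] H := inclusionFamily DK DV hKV ((2 * π : ℂ)⁻¹ * log (1 + σ))

/-- The logarithmic coordinate of the closed upper half-plane lies in the closed strip. [folklore] -/
theorem log_coord_mem_closedStrip {σ : ℂ} (hσ : 0 ≤ σ.im) : (2 * π : ℂ)⁻¹ * log (1 + σ) ∈ closedStrip 2⁻¹ := by
  rw [mem_closedStrip_iff, show (2 * π : ℂ)⁻¹ = (((2 * π)⁻¹ : ℝ) : ℂ) by push_cast; ring, im_ofReal_mul, log_im]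
  have h2π : 0 < (2 * π)⁻¹ := by positivity
  constructor
  · exact mul_nonneg h2π.le (arg_nonneg_iff.2 (by simpa using hσ))
  · calc (2 * π)⁻¹ * arg (1 + σ) ≤ (2 * π)⁻¹ * π := by gcongr; exact arg_le_pi _
      _ = 2⁻¹ := by field_simp

/-- The logarithmic coordinate of the open upper half-plane lies in the open strip. [folklore] -/
theorem log_coord_mem_openStrip {σ : ℂ} (hσ : 0 < σ.im) : (2 * π : ℂ)⁻¹ * log (1 + σ) ∈ openStrip 2⁻¹ := by
  rw [mem_openStrip_iff, show (2 * π : ℂ)⁻¹ = (((2 * π)⁻¹ : ℝ) : ℂ) by push_cast; ring, im_ofReal_mul, log_im]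
  have h2π : 0 < (2 * π)⁻¹ := by positivity
  have him : 0 < (1 + σ).im := by simpa using hσ
  constructor
  · refine mul_pos h2π (lt_of_le_of_ne (arg_nonneg_iff.2 him.le) fun h => ?_)
    exact him.ne' (arg_eq_zero_iff.1 h.symm).2
  · have hlt : arg (1 + σ) < π := arg_lt_pi_iff.2 (Or.inr him.ne')
    calc (2 * π)⁻¹ * arg (1 + σ) < (2 * π)⁻¹ * π := by gcongr
      _ = 2⁻¹ := by field_simp

/-- **`Ũ` is holomorphic on the open upper half-plane** (in operator norm). [cite: Longo2008LecturesConformalNets, Thm. 2.4.1 (proof, (2.4.5))] -/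
theorem differentiableOn_translationExt : DifferentiableOn ℂ (translationExt DK DV hKV) {σ : ℂ | 0 < σ.im} := by
  intro σ hσ
  have hlog : DifferentiableAt ℂ (fun σ : ℂ => (2 * π : ℂ)⁻¹ * log (1 + σ)) σ :=
    (((differentiableAt_const _).add differentiableAt_id).clog
      (mem_slitPlane_iff.2 (Or.inr (by simpa using (show 0 < σ.im from hσ).ne')))).const_mul _
  have hW := (differentiableOn_inclusionFamily DK DV hKV).differentiableAt
    ((isOpen_openStrip _).mem_nhds (log_coord_mem_openStrip hσ))
  exact (hW.comp σ hlog).differentiableWithinAt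

/-- `‖Ũ(σ)‖ ≤ 1`. [cite: Longo2008LecturesConformalNets, Thm. 2.4.1 (proof, (2.4.5))] -/
theorem opNorm_translationExt_le (σ : ℂ) : ‖translationExt DK DV hKV σ‖ ≤ 1 := opNorm_inclusionFamily_le DK DV hKV _

/-- The logarithmic coordinate is continuous on `{Im ≥ 0} ∖ {-1}` within the closed upper half-plane. [folklore] -/
theorem continuousOn_log_coord : ContinuousOn (fun σ : ℂ => (2 * π : ℂ)⁻¹ * log (1 + σ)) ({σ : ℂ | 0 ≤ σ.im} \ {-1}) := by
  intro σ hσ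
  have hE : ContinuousWithinAt (fun w : ℂ => 1 + w) ({σ : ℂ | 0 ≤ σ.im} \ {-1}) σ :=
    (continuous_const.add continuous_id).continuousWithinAt
  have hmaps : MapsTo (fun w : ℂ => 1 + w) ({σ : ℂ | 0 ≤ σ.im} \ {-1}) {w : ℂ | 0 ≤ w.im} := by
    intro w hw; simpa using hw.1
  have hne : 1 + σ ≠ 0 := fun h0 => hσ.2 (by
    have : σ = -1 := by linear_combination h0
    exact this)
  have hlog : ContinuousWithinAt log {w : ℂ | 0 ≤ w.im} (1 + σ) := by
    by_cases hs : 1 + σ ∈ slitPlane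
    · exact (continuousAt_clog hs).continuousWithinAt
    · rw [mem_slitPlane_iff, not_or, not_lt, not_ne_iff] at hs
      refine continuousWithinAt_log_of_re_neg_of_im_zero (lt_of_le_of_ne hs.1 fun h => hne ?_) hs.2
      exact Complex.ext h hs.2
  have hcomp : ContinuousWithinAt (fun w : ℂ => log (1 + w)) ({σ : ℂ | 0 ≤ σ.im} \ {-1}) σ :=
    hlog.comp (f := fun w : ℂ => 1 + w) hE hmaps
  exact hcomp.const_mul ((2 * π : ℂ)⁻¹)

/-- **Weak continuity of `Ũ` from the closed upper half-plane** at every point off `-1`, for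
norm-continuous vector functions in both slots. [cite: Longo2008LecturesConformalNets, Thm. 2.4.1 (proof, (2.4.5))] -/
theorem continuousOn_inner_translationExt_comp {s : Set ℂ} {a b : ℂ → H} {φ : ℂ → ℂ}
    (ha : ContinuousOn a s) (hb : ContinuousOn b s) (hφ : ContinuousOn φ s)
    (hmaps : MapsTo φ s ({σ : ℂ | 0 ≤ σ.im} \ {-1})) :
    ContinuousOn (fun z => ⟪a z, translationExt DK DV hKV (φ z) (b z)⟫_ℂ) s :=
  continuousOn_inner_inclusionFamily_comp DK DV hKV ha hb (continuousOn_log_coord.comp hφ hmaps)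
    fun _ hz => log_coord_mem_closedStrip (hmaps hz).1

/-- **Real values `Ũ(x) = U(x)` for `x > -1`**. [cite: Longo2008LecturesConformalNets, Thm. 2.4.1 (proof, (2.4.5))] -/
theorem translationExt_ofReal (h : IsHalfSidedModularInclusion K V DV) {x : ℝ} (hx : -1 < x) :
    translationExt DK DV h.le x = (translationGroup (DK := DK) h).appReal x := by
  rw [translationGroup_appReal_eq_localGroup h hx, translationExt, localGroup]
  congr 1
  rw [show (1 : ℂ) + x = ((1 + x : ℝ) : ℂ) by push_cast; ring, ← ofReal_log (by linarith), logCoord]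
  push_cast; ring

/-- Continuity from above of `σ ↦ ⟪a, Ũ(σ) b⟫` at a real point `x > -1`. [folklore] -/
theorem continuousWithinAt_inner_translationExt (a b : H) {x : ℝ} (hx : -1 < x) :
    ContinuousWithinAt (fun σ => ⟪a, translationExt DK DV hKV σ b⟫_ℂ) {σ : ℂ | 0 ≤ σ.im} x := by
  have hs : ContinuousOn (fun σ => ⟪a, translationExt DK DV hKV σ b⟫_ℂ) ({σ : ℂ | 0 ≤ σ.im} \ {-1}) :=
    continuousOn_inner_translationExt_comp DK DV hKV continuousOn_const continuousOn_const continuousOn_id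
      (mapsTo_id _)
  have hxmem : (x : ℂ) ∈ {σ : ℂ | 0 ≤ σ.im} \ {-1} := by
    refine ⟨by simp, fun hx1 => ?_⟩
    have := congrArg re hx1
    simp at this
    linarith
  refine (hs x hxmem).mono_of_mem_nhdsWithin ?_
  exact inter_mem_nhdsWithin _ (isOpen_ne.mem_nhds hxmem.2)

/-- Continuity from above of the shifted coefficient `σ ↦ ⟪a, Ũ(σ + s) b⟫` at a real point `r` with `r + s > -1`. [folklore] -/
theorem continuousWithinAt_inner_translationExt_add (a b : H) (s : ℝ) {r : ℝ} (hr : -1 < r + s) :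
    ContinuousWithinAt (fun σ => ⟪a, translationExt DK DV hKV (σ + s) b⟫_ℂ) {σ : ℂ | 0 ≤ σ.im} r := by
  have hg := continuousWithinAt_inner_translationExt DK DV hKV a b hr
  rw [ofReal_add] at hg
  exact hg.comp (f := fun σ : ℂ => σ + s) ((continuous_id.add continuous_const).continuousWithinAt)
    (fun σ hσ => by simpa using hσ)

/-- Holomorphy of `σ ↦ Ũ(σ + s)` on the upper half-plane (real `s`). [folklore] -/
theorem differentiableOn_translationExt_add (s : ℝ) :
    DifferentiableOn ℂ (fun σ => translationExt DK DV hKV (σ + s)) {σ : ℂ | 0 < σ.im} :=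
  (differentiableOn_translationExt DK DV hKV).comp (differentiableOn_id.add_const _) fun σ hσ => by
    simpa using hσ

omit [CompleteSpace H] in
/-- Two bounded operators with equal matrix coefficients are equal. [folklore] -/
theorem clm_eq_of_forall_inner_apply_eq {A B : H →L[ℂ] H} (hAB : ∀ a c : H, ⟪a, A c⟫_ℂ = ⟪a, B c⟫_ℂ) : A = B :=
  ContinuousLinearMap.ext fun c => ext_inner_left ℂ fun a => hAB a c

/-- **`Ũ(σ + s) = U(s) Ũ(σ)`** for `Im σ > 0` and every real `s` (analytic continuation of the group
law from the real points `r > -1`, `r + s > -1`, by boundary uniqueness across a segment,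
`Literature.Analysis.Complex.eq_zero_of_eqOn_real_segment`). [cite: Longo2008LecturesConformalNets, Thm. 2.4.1 (proof, (2.4.5))] -/
theorem translationExt_add_ofReal_left (h : IsHalfSidedModularInclusion K V DV) {σ : ℂ} (hσ : 0 < σ.im) (s : ℝ) :
    translationExt DK DV h.le (σ + s) = (translationGroup (DK := DK) h).appReal s * translationExt DK DV h.le σ := by
  set T := translationGroup (DK := DK) h with hT
  refine clm_eq_of_forall_inner_apply_eq fun a c => ?_
  -- the holomorphic function `f(σ) = ⟪a, Ũ(σ + s) c⟫ - ⟪U(-s) a, Ũ(σ) c⟫`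
  set m : ℝ := max (-1) (-1 - s) with hm
  have key := Literature.Analysis.Complex.eq_zero_of_eqOn_real_segment (a := m) (b := m + 1) (by linarith)
    (f := fun σ => ⟪a, translationExt DK DV h.le (σ + s) c⟫_ℂ - ⟪T.appReal (-s) a, translationExt DK DV h.le σ c⟫_ℂ)
    ?_ ?_ ?_ hσ
  · rw [sub_eq_zero] at key
    rw [key, mul_apply_eq_comp, ModularData.inner_appReal_right_eq]
  · exact ((((innerSL ℂ a).differentiable).comp_differentiableOn
      ((differentiableOn_translationExt_add DK DV h.le s).clm_apply (differentiableOn_const c))).sub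
      (((innerSL ℂ (T.appReal (-s) a)).differentiable).comp_differentiableOn
        ((differentiableOn_translationExt DK DV h.le).clm_apply (differentiableOn_const c))))
  · intro r hr
    have hr1 : -1 < r := lt_of_le_of_lt (le_max_left _ _) hr.1
    have hr2 : -1 < r + s := by have := lt_of_le_of_lt (le_max_right _ _) hr.1; linarith
    exact (continuousWithinAt_inner_translationExt_add DK DV h.le a c s hr2).sub
      (continuousWithinAt_inner_translationExt DK DV h.le _ c hr1)
  · intro r hr
    have hr1 : -1 < r := lt_of_le_of_lt (le_max_left _ _) hr.1
    have hr2 : -1 < r + s := by have := lt_of_le_of_lt (le_max_right _ _) hr.1; linarith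
    rw [← ofReal_add, translationExt_ofReal DK DV h hr2, translationExt_ofReal DK DV h hr1, sub_eq_zero,
      ← ModularData.inner_appReal_right_eq, ← mul_apply_eq_comp, ← UnitaryRep.appReal_add, add_comm]

/-- **`Ũ(σ + s) = Ũ(σ) U(s)`** for `Im σ > 0` and every real `s`. [cite: Longo2008LecturesConformalNets, Thm. 2.4.1 (proof, (2.4.5))] -/
theorem translationExt_add_ofReal_right (h : IsHalfSidedModularInclusion K V DV) {σ : ℂ} (hσ : 0 < σ.im) (s : ℝ) :
    translationExt DK DV h.le (σ + s) = translationExt DK DV h.le σ * (translationGroup (DK := DK) h).appReal s := by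
  set T := translationGroup (DK := DK) h with hT
  refine clm_eq_of_forall_inner_apply_eq fun a c => ?_
  set m : ℝ := max (-1) (-1 - s) with hm
  have key := Literature.Analysis.Complex.eq_zero_of_eqOn_real_segment (a := m) (b := m + 1) (by linarith)
    (f := fun σ => ⟪a, translationExt DK DV h.le (σ + s) c⟫_ℂ - ⟪a, translationExt DK DV h.le σ (T.appReal s c)⟫_ℂ)
    ?_ ?_ ?_ hσ
  · rw [sub_eq_zero] at key
    rw [key, mul_apply_eq_comp]
  · exact ((((innerSL ℂ a).differentiable).comp_differentiableOn
      ((differentiableOn_translationExt_add DK DV h.le s).clm_apply (differentiableOn_const c))).sub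
      (((innerSL ℂ a).differentiable).comp_differentiableOn
        ((differentiableOn_translationExt DK DV h.le).clm_apply (differentiableOn_const _))))
  · intro r hr
    have hr1 : -1 < r := lt_of_le_of_lt (le_max_left _ _) hr.1
    have hr2 : -1 < r + s := by have := lt_of_le_of_lt (le_max_right _ _) hr.1; linarith
    exact (continuousWithinAt_inner_translationExt_add DK DV h.le a c s hr2).sub
      (continuousWithinAt_inner_translationExt DK DV h.le a _ hr1)
  · intro r hr
    have hr1 : -1 < r := lt_of_le_of_lt (le_max_left _ _) hr.1
    have hr2 : -1 < r + s := by have := lt_of_le_of_lt (le_max_right _ _) hr.1; linarith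
    rw [← ofReal_add, translationExt_ofReal DK DV h hr2, translationExt_ofReal DK DV h hr1, sub_eq_zero,
      ← mul_apply_eq_comp, ← UnitaryRep.appReal_add]

end Extension


section Positivity

variable {H : Type*} [NormedAddCommGroup H] [InnerProductSpace ℂ H] [CompleteSpace H]
variable {K V : StandardSubspace H} (DK : ModularData K) (DV : ModularData V)

/-- `Ũ(0) = 1` (as `Ũ(i·0)`). [folklore] -/
theorem translationExt_I_mul_zero (h : IsHalfSidedModularInclusion K V DV) :
    translationExt DK DV h.le (I * (0 : ℝ)) = 1 := by
  rw [ofReal_zero, mul_zero, ← ofReal_zero, translationExt_ofReal DK DV h (by norm_num), UnitaryRep.appReal_zero]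

/-- **The contraction semigroup `R(b) = Ũ(ib)` commutes with the translations.**
[cite: Longo2008LecturesConformalNets, Thm. 2.4.1 (proof, (2.4.5))] -/
theorem translation_mul_translationExt_I (h : IsHalfSidedModularInclusion K V DV) {b : ℝ} (hb : 0 ≤ b) (s : ℝ) :
    (translationGroup (DK := DK) h).appReal s * translationExt DK DV h.le (I * b) =
      translationExt DK DV h.le (I * b) * (translationGroup (DK := DK) h).appReal s := by
  rcases hb.eq_or_lt with rfl | hb'
  · rw [translationExt_I_mul_zero DK DV h, mul_one, one_mul]
  · have hσ : 0 < (I * (b : ℂ)).im := by simpa using hb'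
    rw [← translationExt_add_ofReal_left DK DV h hσ, translationExt_add_ofReal_right DK DV h hσ]

/-- **The orbit of `x ∈ D(A)` is differentiable at `0` with derivative `A x`** (two-sided; the tree's
`OneParameterGroup.tendsto_generator_two_sided_holds`). [folklore] -/
theorem hasDerivAt_appReal_apply (U : OneParameterUnitaryGroup H)
    (x : (OneParameterGroup.generator U.toStrongContRepresentation).domain) :
    HasDerivAt (fun t : ℝ => U.appReal t x) (OneParameterGroup.generator U.toStrongContRepresentation x : H) 0 := by
  rw [hasDerivAt_iff_tendsto_slope_zero]
  refine (OneParameterGroup.tendsto_generator_two_sided_holds U.toStrongContRepresentation x).congr' ?_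
  filter_upwards [self_mem_nhdsWithin] with t _
  rw [zero_add, UnitaryRep.app_toStrongContRepresentation, UnitaryRep.appReal_zero, one_apply_eq_self,
    ← RCLike.real_smul_eq_coe_smul (K := ℂ)]

/-- **A bounded operator commuting with a unitary group preserves the domain of its generator** and
commutes with the generator (Reed–Simon I, Thm. VIII.7-type calculus; here elementary). [folklore] -/
theorem generator_apply_of_commute (U : OneParameterUnitaryGroup H) {B : H →L[ℂ] H}
    (hB : ∀ t : ℝ, U.appReal t * B = B * U.appReal t)
    (x : (OneParameterGroup.generator U.toStrongContRepresentation).domain) :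
    ∃ hx : B x ∈ (OneParameterGroup.generator U.toStrongContRepresentation).domain,
      OneParameterGroup.generator U.toStrongContRepresentation ⟨B x, hx⟩ =
        B (OneParameterGroup.generator U.toStrongContRepresentation x) := by
  apply OneParameterGroup.mem_generator_domain_of_hasDerivAt
  have h1 := (B.restrictScalars ℝ).hasFDerivAt.comp_hasDerivAt (0 : ℝ) (hasDerivAt_appReal_apply U x)
  simp only [ContinuousLinearMap.coe_restrictScalars'] at h1
  refine h1.congr_of_eventuallyEq (Eventually.of_forall fun t => ?_)
  show U.appReal t (B x) = B (U.appReal t x)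
  rw [← mul_apply_eq_comp, hB, mul_apply_eq_comp]

/-- **Strong continuity of `R(b) = Ũ(ib)` at `b = 0⁺`** (weak continuity plus `‖R(b)‖ ≤ 1`).
[cite: Longo2008LecturesConformalNets, Thm. 2.4.1 (proof, (2.4.5))] -/
theorem tendsto_translationExt_I_mul (h : IsHalfSidedModularInclusion K V DV) (v : H) :
    Tendsto (fun b : ℝ => translationExt DK DV h.le (I * b) v) (𝓝[≥] 0) (𝓝 v) := by
  -- weak convergence `⟪v, R(b) v⟫ → ⟪v, v⟫`
  have hI : Tendsto (fun b : ℝ => I * (b : ℂ)) (𝓝[≥] (0 : ℝ)) (𝓝[{σ : ℂ | 0 ≤ σ.im}] ((0 : ℝ) : ℂ)) := by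
    refine tendsto_nhdsWithin_iff.2 ⟨?_, ?_⟩
    · have : Continuous fun b : ℝ => I * (b : ℂ) := by fun_prop
      simpa using (this.tendsto 0).mono_left nhdsWithin_le_nhds
    · filter_upwards [self_mem_nhdsWithin] with b hb
      simpa using hb
  have hweak : Tendsto (fun b : ℝ => ⟪v, translationExt DK DV h.le (I * b) v⟫_ℂ) (𝓝[≥] 0) (𝓝 ⟪v, v⟫_ℂ) := by
    have hc := continuousWithinAt_inner_translationExt DK DV h.le v v (x := 0) (by norm_num)
    have h0 : translationExt DK DV h.le ((0 : ℝ) : ℂ) v = v := by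
      rw [translationExt_ofReal DK DV h (by norm_num), UnitaryRep.appReal_zero, one_apply_eq_self]
    have := hc.tendsto.comp hI
    rw [Function.comp_def, h0] at this
    exact this
  -- `‖R(b) v - v‖² ≤ 2 (‖v‖² - Re ⟪v, R(b) v⟫)`
  have hbound : ∀ b : ℝ, ‖translationExt DK DV h.le (I * b) v - v‖ ≤
      Real.sqrt (2 * (‖v‖ ^ 2 - (⟪v, translationExt DK DV h.le (I * b) v⟫_ℂ).re)) := by
    intro b
    apply Real.le_sqrt_of_sq_le
    rw [@norm_sub_sq ℂ, ← inner_conj_symm, RCLike.conj_re, RCLike.re_to_complex]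
    have h1 : ‖translationExt DK DV h.le (I * b) v‖ ≤ ‖v‖ := by
      calc ‖translationExt DK DV h.le (I * b) v‖ ≤ ‖translationExt DK DV h.le (I * b)‖ * ‖v‖ := ContinuousLinearMap.le_opNorm _ _
        _ ≤ 1 * ‖v‖ := by gcongr; exact opNorm_translationExt_le DK DV h.le _
        _ = ‖v‖ := one_mul _
    nlinarith [norm_nonneg (translationExt DK DV h.le (I * b) v), norm_nonneg v]
  have hlim : Tendsto (fun b : ℝ => Real.sqrt (2 * (‖v‖ ^ 2 - (⟪v, translationExt DK DV h.le (I * b) v⟫_ℂ).re)))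
      (𝓝[≥] 0) (𝓝 0) := by
    have h1 : Tendsto (fun b : ℝ => 2 * (‖v‖ ^ 2 - (⟪v, translationExt DK DV h.le (I * b) v⟫_ℂ).re)) (𝓝[≥] 0)
        (𝓝 (2 * (‖v‖ ^ 2 - (⟪v, v⟫_ℂ).re))) :=
      ((Complex.continuous_re.tendsto _).comp hweak).const_sub _ |>.const_mul 2
    have hre : (⟪v, v⟫_ℂ).re = ‖v‖ ^ 2 := by rw [← RCLike.re_to_complex]; exact inner_self_eq_norm_sq v
    rw [hre, sub_self, mul_zero] at h1
    have h3 := (Real.continuous_sqrt.tendsto 0).comp h1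
    rw [Real.sqrt_zero] at h3
    exact h3
  rw [tendsto_iff_norm_sub_tendsto_zero]
  exact squeeze_zero (fun b => norm_nonneg _) hbound hlim

/-- Continuity of `b ↦ R(b) v` on `[0, ∞)`. [cite: Longo2008LecturesConformalNets, Thm. 2.4.1 (proof, (2.4.5))] -/
theorem continuousOn_translationExt_I_mul (h : IsHalfSidedModularInclusion K V DV) (v : H) :
    ContinuousOn (fun b : ℝ => translationExt DK DV h.le (I * b) v) (Ici 0) := by
  intro b hb
  rcases eq_or_lt_of_le (show (0 : ℝ) ≤ b from hb) with hb0 | hb'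
  · subst hb0
    have := tendsto_translationExt_I_mul DK DV h v
    rw [ContinuousWithinAt, ofReal_zero, mul_zero]
    rw [← ofReal_zero, translationExt_ofReal DK DV h (by norm_num), UnitaryRep.appReal_zero, one_apply_eq_self]
    exact this
  · have hσ : 0 < (I * (b : ℂ)).im := by simpa using hb'
    have hd : DifferentiableAt ℂ (fun σ => translationExt DK DV h.le σ v) (I * b) :=
      ((differentiableOn_translationExt DK DV h.le).clm_apply (differentiableOn_const v)).differentiableAt
        ((isOpen_lt continuous_const continuous_im).mem_nhds hσ)
    have hin : ContinuousAt (fun b : ℝ => I * (b : ℂ)) b := by fun_prop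
    exact (hd.continuousAt.comp (f := fun b : ℝ => I * (b : ℂ)) hin).continuousWithinAt

variable (h : IsHalfSidedModularInclusion K V DV)

/-- **`b ↦ R(b) x` is differentiable for `b > 0` with derivative `i R(b) A x`** for `x ∈ D(A)`, `A` the
generator of the translations (Cauchy–Riemann for the holomorphic `σ ↦ Ũ(σ) x`, whose derivative in
the real direction is that of the orbit `s ↦ U(s) R(b) x`). [cite: Longo2008LecturesConformalNets, Thm. 2.4.1 (proof, (2.4.5))] -/
theorem hasDerivAt_translationExt_I_mul {b₀ : ℝ} (hb₀ : 0 < b₀) (x : (OneParameterGroup.generator (translationGroup (DK := DK) h).toStrongContRepresentation).domain) :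
    HasDerivAt (fun b : ℝ => translationExt DK DV h.le (I * b) x)
      (I • translationExt DK DV h.le (I * b₀) ((OneParameterGroup.generator (translationGroup (DK := DK) h).toStrongContRepresentation) x)) b₀ := by
  have hσ₀ : 0 < (I * (b₀ : ℂ)).im := by simpa using hb₀
  -- `y(σ) = Ũ(σ) x` is complex differentiable at `i b₀`
  have hyd : DifferentiableAt ℂ (fun σ => translationExt DK DV h.le σ x) (I * b₀) :=
    ((differentiableOn_translationExt DK DV h.le).clm_apply (differentiableOn_const (x : H))).differentiableAt
      ((isOpen_lt continuous_const continuous_im).mem_nhds hσ₀)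
  have hyD : HasDerivAt (fun σ => translationExt DK DV h.le σ x) (deriv (fun σ => translationExt DK DV h.le σ x) (I * b₀))
      (I * b₀) := hyd.hasDerivAt
  -- (i) the real direction identifies the derivative: `= A (R(b₀) x) = R(b₀) (A x)`
  obtain ⟨hRx, hAR⟩ := generator_apply_of_commute (translationGroup (DK := DK) h)
    (fun t => translation_mul_translationExt_I DK DV h hb₀.le t) x
  have h₁ : HasDerivAt (fun r : ℝ => translationExt DK DV h.le (I * b₀ + r) x)
      (deriv (fun σ => translationExt DK DV h.le σ x) (I * b₀)) 0 := by
    have hin : HasDerivAt (fun r : ℝ => I * b₀ + ((id r : ℝ) : ℂ)) ((1 : ℝ) : ℂ) 0 :=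
      ((hasDerivAt_id (0 : ℝ)).ofReal_comp).const_add (I * b₀)
    have h1' := hyD.scomp_of_eq (0 : ℝ) hin (by simp)
    simp only [Function.comp_def, id, ofReal_one, one_smul] at h1'
    exact h1'
  have h₂ : HasDerivAt (fun r : ℝ => translationExt DK DV h.le (I * b₀ + r) x) ((OneParameterGroup.generator (translationGroup (DK := DK) h).toStrongContRepresentation) ⟨_, hRx⟩ : H) 0 := by
    have horb := hasDerivAt_appReal_apply (translationGroup (DK := DK) h) ⟨_, hRx⟩
    refine horb.congr_of_eventuallyEq (Eventually.of_forall fun r => ?_)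
    show translationExt DK DV h.le (I * b₀ + r) x =
      (translationGroup (DK := DK) h).appReal r (translationExt DK DV h.le (I * ↑b₀) x)
    rw [translationExt_add_ofReal_left DK DV h hσ₀, mul_apply_eq_comp]
  have hdA : deriv (fun σ => translationExt DK DV h.le σ x) (I * b₀) = translationExt DK DV h.le (I * b₀) ((OneParameterGroup.generator (translationGroup (DK := DK) h).toStrongContRepresentation) x) := by
    rw [h₁.unique h₂, hAR]
  -- (ii) the imaginary direction
  have hin : HasDerivAt (fun b : ℝ => I * (b : ℂ)) (I * 1) b₀ := (hasDerivAt_id b₀).ofReal_comp.const_mul I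
  have := hyD.scomp b₀ hin
  rw [mul_one, hdA] at this
  exact this

/-- **`Re ⟪x, i A x⟫ ≤ 0` for `x ∈ D(A)`**: `‖R(b) x‖² ≤ ‖x‖²` and the mean value theorem give points
`c ↓ 0` with `d/db ‖R(b) x‖² |_{b = c} = 2 Re ⟪R(c) x, i R(c) A x⟫ ≤ 0`; let `c → 0`.
[cite: Longo2008LecturesConformalNets, Thm. 2.4.1 (proof, (2.4.5))] -/
theorem re_inner_I_smul_generator_nonpos (x : (OneParameterGroup.generator (translationGroup (DK := DK) h).toStrongContRepresentation).domain) : (⟪(x : H), I • ((OneParameterGroup.generator (translationGroup (DK := DK) h).toStrongContRepresentation) x : H)⟫_ℂ).re ≤ 0 := by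
  -- the functions `ψ(b) = ‖R(b) x‖²` and `ψ'`
  have hR0 : translationExt DK DV h.le (I * (0 : ℝ)) = 1 := translationExt_I_mul_zero DK DV h
  have hψle : ∀ b : ℝ, (⟪translationExt DK DV h.le (I * b) x, translationExt DK DV h.le (I * b) x⟫_ℂ).re ≤
      (⟪translationExt DK DV h.le (I * (0 : ℝ)) x, translationExt DK DV h.le (I * (0 : ℝ)) x⟫_ℂ).re := by
    intro b
    have hre : ∀ w : H, (⟪w, w⟫_ℂ).re = ‖w‖ ^ 2 := fun w => by
      rw [← RCLike.re_to_complex]; exact inner_self_eq_norm_sq w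
    rw [hre, hre, hR0, one_apply_eq_self]
    have : ‖translationExt DK DV h.le (I * b) x‖ ≤ ‖(x : H)‖ := by
      calc ‖translationExt DK DV h.le (I * b) x‖ ≤ ‖translationExt DK DV h.le (I * b)‖ * ‖(x : H)‖ := ContinuousLinearMap.le_opNorm _ _
        _ ≤ 1 * ‖(x : H)‖ := by gcongr; exact opNorm_translationExt_le DK DV h.le _
        _ = ‖(x : H)‖ := one_mul _
    nlinarith [norm_nonneg (translationExt DK DV h.le (I * b) x)]
  have hderiv : ∀ c : ℝ, 0 < c →
      HasDerivAt (fun b : ℝ => (⟪translationExt DK DV h.le (I * b) x, translationExt DK DV h.le (I * b) x⟫_ℂ).re)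
        ((⟪translationExt DK DV h.le (I * c) x, I • translationExt DK DV h.le (I * c) ((OneParameterGroup.generator (translationGroup (DK := DK) h).toStrongContRepresentation) x)⟫_ℂ +
          ⟪I • translationExt DK DV h.le (I * c) ((OneParameterGroup.generator (translationGroup (DK := DK) h).toStrongContRepresentation) x), translationExt DK DV h.le (I * c) x⟫_ℂ).re) c := by
    intro c hc
    have hRd := hasDerivAt_translationExt_I_mul DK DV h hc x
    exact Complex.reCLM.hasFDerivAt.comp_hasDerivAt c (hRd.inner ℂ hRd)
  have hψcont : ContinuousOn
      (fun b : ℝ => (⟪translationExt DK DV h.le (I * b) x, translationExt DK DV h.le (I * b) x⟫_ℂ).re) (Ici 0) :=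
    Complex.continuous_re.comp_continuousOn
      ((continuousOn_translationExt_I_mul DK DV h x).inner (continuousOn_translationExt_I_mul DK DV h x))
  -- mean value theorem on `[0, 1/(n+1)]`
  have hmvt : ∀ n : ℕ, ∃ c ∈ Ioo (0 : ℝ) (1 / (n + 1)),
      (⟪translationExt DK DV h.le (I * c) x, I • translationExt DK DV h.le (I * c) ((OneParameterGroup.generator (translationGroup (DK := DK) h).toStrongContRepresentation) x)⟫_ℂ +
        ⟪I • translationExt DK DV h.le (I * c) ((OneParameterGroup.generator (translationGroup (DK := DK) h).toStrongContRepresentation) x), translationExt DK DV h.le (I * c) x⟫_ℂ).re ≤ 0 := by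
    intro n
    have hb : (0 : ℝ) < 1 / (n + 1) := by positivity
    obtain ⟨c, hc, hceq⟩ := exists_hasDerivAt_eq_slope
      (fun b : ℝ => (⟪translationExt DK DV h.le (I * b) x, translationExt DK DV h.le (I * b) x⟫_ℂ).re) _ hb
      (hψcont.mono Icc_subset_Ici_self) (fun c hc => hderiv c hc.1)
    refine ⟨c, hc, ?_⟩
    rw [hceq, sub_zero]
    refine div_nonpos_of_nonpos_of_nonneg ?_ hb.le
    have := hψle (1 / (n + 1))
    push_cast at this ⊢
    linarith
  choose c hc hcle using hmvt
  -- `c n → 0⁺`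
  have hc0 : Tendsto c atTop (𝓝[≥] 0) := by
    refine tendsto_nhdsWithin_iff.2 ⟨?_, Eventually.of_forall fun n => (hc n).1.le⟩
    exact squeeze_zero (fun n => (hc n).1.le) (fun n => (hc n).2.le) tendsto_one_div_add_atTop_nhds_zero_nat
  have hRc : ∀ v : H, Tendsto (fun n => translationExt DK DV h.le (I * c n) v) atTop (𝓝 v) := fun v =>
    (tendsto_translationExt_I_mul DK DV h v).comp hc0
  -- the limit of `ψ' (c n)`
  have hlim : Tendsto (fun n =>
      (⟪translationExt DK DV h.le (I * c n) x, I • translationExt DK DV h.le (I * c n) ((OneParameterGroup.generator (translationGroup (DK := DK) h).toStrongContRepresentation) x)⟫_ℂ +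
        ⟪I • translationExt DK DV h.le (I * c n) ((OneParameterGroup.generator (translationGroup (DK := DK) h).toStrongContRepresentation) x), translationExt DK DV h.le (I * c n) x⟫_ℂ).re)
      atTop (𝓝 ((⟪(x : H), I • ((OneParameterGroup.generator (translationGroup (DK := DK) h).toStrongContRepresentation) x : H)⟫_ℂ + ⟪I • ((OneParameterGroup.generator (translationGroup (DK := DK) h).toStrongContRepresentation) x : H), (x : H)⟫_ℂ).re)) := by
    refine (Complex.continuous_re.tendsto _).comp ?_
    exact ((hRc x).inner (((hRc _).const_smul I))).add ((((hRc _).const_smul I)).inner (hRc x))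
  have hle : (⟪(x : H), I • ((OneParameterGroup.generator (translationGroup (DK := DK) h).toStrongContRepresentation) x : H)⟫_ℂ + ⟪I • ((OneParameterGroup.generator (translationGroup (DK := DK) h).toStrongContRepresentation) x : H), (x : H)⟫_ℂ).re ≤ 0 :=
    le_of_tendsto' hlim fun n => hcle n
  rw [← inner_conj_symm (I • ((OneParameterGroup.generator (translationGroup (DK := DK) h).toStrongContRepresentation) x : H)) (x : H), add_re, conj_re, ← two_mul] at hle
  linarith

/-- **The translations have positive energy** (Longo (2.4.5): "`U(s) = e^{isP}` for some positive
selfadjoint operator `P`"): `Re ⟪x, P x⟫ = -Re ⟪x, i A x⟫ ≥ 0` on `D(P) = D(A)`, `P = -iA`, together with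
the symmetry of `P` (`UnitaryRep.hamiltonian_isSymmetric`). [cite: Longo2008LecturesConformalNets, Thm. 2.4.1 (2.4.5)] -/
theorem hasPositiveEnergy_translationGroup : (translationGroup (DK := DK) h).HasPositiveEnergy := by
  refine ⟨(translationGroup (DK := DK) h).hamiltonian_isSymmetric, fun x => ?_⟩
  have key := re_inner_I_smul_generator_nonpos DK DV h x
  rw [UnitaryRep.hamiltonian_apply, inner_smul_right]
  rw [inner_smul_right] at key
  simp only [RCLike.re_to_complex, Complex.mul_re, Complex.neg_re, Complex.neg_im, Complex.I_re,
    Complex.I_im] at key ⊢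
  linarith

end Positivity

/-! ### The theorem -/

section Main

/-- **Discharge of `Wiesbrock_oneParticle`** — Wiesbrock's theorem, one-particle (standard subspace)
version (Longo, *Lectures on Conformal Nets* I, Thm. 2.4.1; H.-W. Wiesbrock, CMP 157 (1993), Thm. 3 /
Cor. 6–7 for von Neumann algebras; complete proof H. Araki, L. Zsidó, RMP 17 (2005), Thm. 2.1). For a
half-sided modular inclusion `K ⊆ V` (`Δ_V^{-it} K ⊆ K`, `t ≥ 0`) the translations
`T = translationGroup h` (`T(e^{2πt} − 1) = Δ_V^{-it} Δ_K^{it}`) form a strongly continuous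
one-parameter unitary group with positive generator, dilation-covariant
(`Δ_V^{-it} T(s) Δ_V^{it} = T(e^{2πt}s)`), with `T(s)V ⊆ V` for `s ≥ 0` and `K = T(1)V`. The proof follows
Longo's (pp. 39–41): the analytic family `W(z) = Δ_V^{-iz} Δ_K^{iz}` (`StandardSubspaceInclusion`), the
change of variable `h(z) = (2π)⁻¹ log(1 + e^{2πz})`, the structure theorem 2.3.3 in the form
`U_mul_inclusionFamily_stripReparam_mul_U` (Phragmén–Lindelöf with one exceptional boundary point in
place of Schwarz reflection + Liouville), the composition law and the local group, the group `T`,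
covariance (2.4.6), positivity of the generator through the bounded holomorphic extension to the
upper half-plane (contraction semigroup `Ũ(ib)`, Cauchy–Riemann and the mean value theorem in place of
the spectral theorem), and `K = T(1)V` through `Δ_V^{it} T(−1) = T(−1) Δ_K^{it}` and the uniqueness of
the polar continuation (in place of Prop. 2.1.10). [cite: Longo2008LecturesConformalNets, Thm. 2.4.1]
[cite: Wiesbrock1993, Thm. 3, Cor. 6–7] [cite: ArakiZsido2005, Thm. 2.1] -/
theorem Wiesbrock_oneParticle_holds : Wiesbrock_oneParticle := by
  intro H _ _ _ K V DK DV hhsm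
  exact ⟨translationGroup (DK := DK) hhsm, hasPositiveEnergy_translationGroup DK DV hhsm,
    fun t => translationGroup_appReal_exp_sub_one hhsm t, fun t s => U_neg_mul_translation_mul_U DK hhsm t s,
    fun s hs x hx => translation_apply_mem_V_of_nonneg DK hhsm hs hx,
    fun x => mem_iff_exists_translation_one DK hhsm x⟩

end Main

end StandardSubspace

end Literature.MathematicalPhysics.AQFT
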